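import Literature.MathematicalPhysics.QuantumFieldTheory.Balaban1983to89.B14Eq366ActionF2

/-!
# `Balaban1983to89.B14.Eq366Irrelevant` — [Balaban1988Convergent] (3.66) p. 283: «(the irrelevant terms)» of the
# localized Wilson action `A(h_z, U_k)` ESTIMATED — `|A(h_z, U_k) − ½Σ_{μ<ν} tr F²_{μν}(z)| ≤ c₂·(LʲL⁻ⁿ)^{5−β}`, the
# input `I₂` of `…B14.Thm2Assembly.PointDataE` (Theorem 2 (2.43) p. 263 ⇐ (3.67))

HONEST FRAMING (cell `pub-ymgap`, Track A DAG node N11 = [B14]; count-neutral): one estimate of ONE STEP of the printed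
proof of Theorem 2 of [III], typed from print's letters and proved; Bałaban's functions are not instantiated; one finite
T⁴ programme at fixed ε; nothing here is a claim about the continuum, ℝ⁴, OS axioms, a mass gap or the Clay problem.

CITATION HEADER (lean-in-tree rule).  T. Bałaban, *Convergent renormalization expansions for lattice gauge theories*,
Commun. Math. Phys. **119** (1988) 243–285, doi:10.1007/bf01217741 [Balaban1988Convergent] (cell paper B14 = «[III]»;
held text `paper:balaban1988-cmp119-convergent-renormalization`, journal page = PDF page + 242; pp. 279–283 [PDF 37–41]
read from the text layer by the author of this file, 2026-08-25).  THE PRINT, verbatim.  p. 283: *«For z ∈ Λ_j⁰ we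
have h_zφ_j = h_z, and the function A(h_z, U_j) is Euclidean covariant. Analyzing A(h_z, U_k) in the same way as
above, we obtain  A(h_z, U_k) = ½ Σ_{μ<ν} tr F²_{μν}(z) + (the irrelevant terms). (3.66)  Thus the first expression
on the right-hand side of the expansion of −β_jA(h_z, U_k) cancels the expression on the right-hand side of (3.61),
and we are left with the irrelevant terms only. … we have the following conclusion: 𝐄^{(j)}(Λ_j, U_k, z) −
𝐄^{(j)}(Λ_j, 1, z) − β_jA(h_z, U_k) = O((LʲL⁻ⁿ)^{5−β}), (3.67) for z ∈ Λ_j⁰∩(Ω_n∖Ω_{n+1}), β > 0.»*; p. 281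
tl. 22–24: *«Let us recall that (the irrelevant terms) above, and in (3.49), denotes the sum of terms which can be
bounded by O((LʲL⁻ⁿ)^{5−β}) exp(−κd_j(X)), where β is a positive number.»*; p. 253: *«The symbol A(φ₁, U₁) means that
we multiply the term in the Wilson action corresponding to a plaquette p by φ₁(x(p))»*; (2.38) p. 261: *«U^u = exp iξA,
Lⁿξ|A|, (Lⁿξ)²|∇^ξA| < BCMα_{0,n}»*; [I] = [Balaban1987RG1] (4.17)–(4.18) p. 285: *«|(∂_νB_μ)(x)| < a₁(Lʲη)²»*,
*«|(∂_λ∂_νB_μ)(x)| < a₁(Lʲη)^{2+β₀}, 0 < β₀ < 1»*.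

WHY THIS FILE (cell `lit-balaban`, `lit-balaban-r11/B14-CLOSURE.md` §3 item 2(i)): of the three «irrelevant»
constituents of (3.67) — the (3.49) remainders `I₁` (`…B14.Eq349IrrelevantFeed`), the second class `G`
(`…B14Eq348SecondClass`) and the (3.66) terms `I₂` — only `I₂` had no estimate in the tree: `…B14.Eq366ActionF2` NAMES
the two irrelevant sums of (3.66) (third-order plaquette remainders + relocation differences `tr F²(x) − tr F²(z)`) and
bounds the first by `Σ_x h_z(x)Σ_{μ<ν} s³/3`, `s = ξΣ|B|` — which, summed over the `ξ⁻⁴` plaquettes under `h_z`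
(`ξ = L⁻ʲ`), is of size `σ³/ξ` (`σ = LʲL⁻ⁿ`), NOT an irrelevant term.  The true plaquette remainder is `O(ξ⁵σ⁵)`; it
needs the even-ness of `1 − Re tr e^W` together with the lattice-curl cancellations `Y₁ + Y₃ = −iξ²∇_νB_μ`,
`Y₂ + Y₄ = iξ²∇_μB_ν` INSIDE the degree-3 and degree-4 components of `Πe^{Yᵢ}`.  This file proves that sharper
expansion and the relocation estimate, and assembles the bound in the shape `PointDataE` consumes.

WHAT IS PROVED (kernel-checked, theorems only, no `def`, no `sorry`, standard axioms).
§1–§2 (folklore analysis) exponential tails of any order `Σ_{N≥n} sᴺ/N! ≤ (sⁿ/n!)eˢ` and their graded-family forms,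
for the exponential majorant `sᴺ/N!` and for the «derivative-type» majorant `N·s^{N−1}/N!`; the `u`- and `v`-derivatives
of the binomial identity over `antidiagonal N`; Cauchy products with one derivative-type factor.  §3 the graded components
`grade4 N` of `e^{Y₁}e^{Y₂}e^{Y₃}e^{Y₄}` ([B11] (34)/(35), `…B11Eq31V4Bound`) are Lipschitz in the third and fourth
exponent with derivative-type weights (`norm_grade4_sub_third_le`, `…_fourth_le`), hence the WHOLE TAIL of degree `≥ k+1`
of `Πe^{Yᵢ} − Πe^{Yᵢ′}` is `≤ (‖Y₃ − Y₃′‖ + ‖Y₄ − Y₄′‖)(sᵏ/k!)eˢ` (`norm_fourExp_sub_fourExp_tail_le`).  §4 degree 4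
of `Πe^{Yᵢ}` explicitly (`twentyfour_smul_grade4_four`, the next line of [B11] (34)) and, at `(X, Y, −X, −Y)`,
`24·grade4 4 = 12[X, Y]² + six commutators` (`…_neg_neg`), so `Re τ(grade4 4) = ½Re τ[X, Y]²` for a trace.  §5 the
abstract expansion `fourExp_re_trace_expansion`: for a normalized trace `τ`, `‖Yᵢ‖ ≤ ε₁` (`4ε₁ ≤ 1`),
`‖Y₁ + Y₃‖, ‖Y₂ + Y₄‖ ≤ ε₂`, `Re τ Z₁ = 0`:
`|[1 − Re τ Πe^{Yᵢ}] + ½Re τ(Z₁ + [Y₄, Y₁])²| ≤ 4ε₂³ + 12ε₁ε₂² + 68ε₁³ε₂ + 26ε₁⁵` (degrees 0–3 exactly by [B11] (34),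
the trace killing `C`, `P`, `T`, `‖C − 2[Y₄, Y₁]‖ ≤ 12ε₁ε₂ + 2ε₂²`; degree 4 at `(Y₁, Y₂, −Y₁, −Y₂)` exactly + §3;
fifth-order tail).  §6 **`plaquette366_sharp`**: in print's variables (`U(x, x + ξe_μ) = exp iξB_μ(x)`, sup size `p`,
gradient size `‖B_μ(x + ξe_ν) − B_μ(x)‖ ≤ ξq`, `4ξp ≤ 1`, `ξ ≤ 1`), since `Z₁ + [Y₄, Y₁] = iξ²F_{μν}(x)`
(`Z1_add_lie_plaq`): `|[1 − Re τ U(∂p_{μν}(x))] − ½ξ⁴Re τ F²_{μν}(x)| ≤ ξ⁵(4q³ + 12pq² + 68p³q + 26p⁵)`.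
§7 **`irrelevant366_le`** — (3.66)'s irrelevant terms ESTIMATED: on the window `{|mᵢ| ≤ N}` of `h_z` in the fine lattice
`ξℤ⁴` around `z` (`ξ = 1/(N + 1) = L⁻ʲ`, d = 4, tent weights and normalization `ξ⁴Σ_x h_z(x) = 1` of
`…Eq366ActionF2.tent_sum_4d_normalized`), for a bond field with print's regularity letters at scale `n` — sup `aσ`,
gradient `ξ·aσ²`, displacement `aσ²`, Hölder letter `ξ·aσ²θ` for `∇B(x) − ∇B(z)`, `0 < σ ≤ θ ≤ 1` (`σ = LʲL⁻ⁿ`,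
`θ = σ^{1−β}` exactly as `…B14.Eq349IrrelevantFeed` reads (I.4.18)), `4aσ ≤ N + 1` — and a normalized trace real on
the lattice curls:  `|A(h_z, U) − ½Σ_{μ<ν} Re τ F²_{μν}(z)| ≤ (24a² + 168a³ + 456a⁴ + 156a⁵)·σ⁴θ`, i.e.
`c₂·(LʲL⁻ⁿ)^{5−β}` with `c₂` EXPLICIT — the shape `|I₂ z| ≤ c₂(L^{j−sc z})^{5−b}` of `PointDataE`.

WHAT IS NOT PROVED HERE (and not claimed).  (i) That Bałaban's minimizers `U_k(V)` restricted to the window of a point of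
`Λ_j⁰∩(Ω_n∖Ω_{n+1})` satisfy the four regularity letters in the local gauge (2.38) — [15] = [Balaban1985Variational]
and [I] §4 (4.16)–(4.18) (rows B12.Eq4.16–4.18); they are hypotheses, as in every (3.49)/(3.67) file of the tree.
(ii) The identification of the abstract normalized trace with `Setup.GaugeGroup.reTr`, and of (3.56)'s `F_{μν}(z)`
here (`plaqF` at the plaquette based at `z`) with the `Q z` of `PointDataE` (the same expression, `…Eq366ActionF2`
docstring).  (iii) The torus bookkeeping (the window is taken in `ℤ⁴`, the support of `h_z`).  (iv) Print states only
the OUTCOME «O((LʲL⁻ⁿ)^{5−β})»; the constants and the route (degree-4 expansion instead of an unspecified «in the same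
way as above») are this file's, recorded as such — an estimate NOT PRINTED AS SUCH, of a printed proof step.
Unit `pub-ymgap-dag-n11-b` (prover, FIRST-MISSING-ESTIMATE seat of DAG node N11; HUMAN RULING D-0062), HOME
`run/shared/lean/pub/pub-ymgap/`; bears on R4∕N11 only through `PointDataE`'s `I₂`.

## References
* [Balaban1988Convergent] T. Bałaban, Commun. Math. Phys. 119 (1988) 243–285: (3.66)–(3.67) p.283, p.281, (2.38) p.261, (3.56) p.281.
* [Balaban1987RG1] T. Bałaban, Commun. Math. Phys. 109 (1987) 249–301 ([I]: (4.16)–(4.18) p.285).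
* [Balaban1985Variational] T. Bałaban, Commun. Math. Phys. 102 (1985) 277–309 ((34)–(35) p.283: `…B11Eq31V4Bound`, `…B11Eq34BCH`).
-/

open NormedSpace Finset
open Complex (I)
open scoped Nat

namespace Literature.MathematicalPhysics.QuantumFieldTheory.Balaban1983to89.B14.Eq366Irrelevant

open Literature.MathematicalPhysics.QuantumFieldTheory.Balaban1983to89.B11Eq31V4Bound
open Literature.MathematicalPhysics.QuantumFieldTheory.Balaban1983to89.B11Eq34BCH (Z1 comm2 comm3pair comm3triple
  prod2 prod3 bch4_degree2 bch4_degree3)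
open Literature.MathematicalPhysics.QuantumFieldTheory.Balaban1983to89.B14.Eq366ActionF2 (trace_lie_eq_zero
  trace_comm2_eq_zero re_trace_real_smul abs_re_trace_le negI_smul_sq plaqD plaqComm plaqF plaqHol Z1_plaq
  re_trace_Z1_plaq negI_smul_Z1_plaq plaqF_sub_comm)

/-! ## §1. Tails of the exponential series of any order; the «derivative-type» majorant -/

section Scalar

/-- `Σ_N s^{N+n}/(N+n)!` sums to `eˢ − Σ_{N<n} sᴺ/N!`. [folklore] -/
private theorem hasSum_exp_tail_gen (s : ℝ) (n : ℕ) :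
    HasSum (fun N : ℕ => s ^ (N + n) / (N + n)!) (Real.exp s - ∑ N ∈ range n, s ^ N / N !) := by
  have hexp : HasSum (fun k : ℕ => s ^ k / k !) (Real.exp s) := by
    rw [Real.exp_eq_exp_ℝ]
    exact expSeries_div_hasSum_exp s
  exact (hasSum_nat_add_iff' n).mpr hexp

/-- `Σ_{N≥n} sᴺ/N! ≤ (sⁿ/n!)eˢ` for `s ≥ 0` (termwise `n!·N! ≤ (N+n)!`). [folklore] -/
private theorem exp_tail_le_gen {s : ℝ} (hs : 0 ≤ s) (n : ℕ) :
    ∑' N : ℕ, s ^ (N + n) / (N + n)! ≤ s ^ n / n ! * Real.exp s := by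
  have hexp : HasSum (fun k : ℕ => s ^ k / k !) (Real.exp s) := by
    rw [Real.exp_eq_exp_ℝ]
    exact expSeries_div_hasSum_exp s
  have htail := hasSum_exp_tail_gen s n
  rw [htail.tsum_eq]
  have hmaj : HasSum (fun k : ℕ => s ^ n / n ! * (s ^ k / k !)) (s ^ n / n ! * Real.exp s) := hexp.mul_left _
  refine hasSum_le (fun N => ?_) htail hmaj
  have hfac : (n ! * N ! : ℕ) ≤ (N + n)! := by
    have := Nat.factorial_mul_factorial_dvd_factorial_add n N
    rw [add_comm] at this
    exact Nat.le_of_dvd (Nat.factorial_pos _) this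
  have hfac' : ((n ! : ℕ) : ℝ) * (N ! : ℝ) ≤ ((N + n)! : ℝ) := by exact_mod_cast hfac
  rw [div_mul_div_comm, ← pow_add, add_comm n N]
  exact div_le_div_of_nonneg_left (by positivity) (by positivity) hfac'

/-- The «derivative-type» weight `N·s^{N−1}/N!` at `N + 1` is the exponential weight `sᴺ/N!`. [folklore] -/
private theorem deriv_weight_succ (s : ℝ) (N : ℕ) :
    ((N + 1 : ℕ) : ℝ) * s ^ (N + 1 - 1) / (N + 1)! = s ^ N / N ! := by
  rw [Nat.add_sub_cancel, Nat.factorial_succ, Nat.cast_mul]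
  have hN : ((N + 1 : ℕ) : ℝ) ≠ 0 := by positivity
  have hF : ((N ! : ℕ) : ℝ) ≠ 0 := by positivity
  field_simp

/-- The derivative-type weights are summable (a shift of the exponential series). [folklore] -/
private theorem summable_deriv_weight (s : ℝ) : Summable fun N : ℕ => (N : ℝ) * s ^ (N - 1) / N ! := by
  refine (summable_nat_add_iff 1).mp ?_
  have hexp : Summable (fun k : ℕ => s ^ k / k !) := by
    have h : HasSum (fun k : ℕ => s ^ k / k !) (Real.exp s) := by
      rw [Real.exp_eq_exp_ℝ]
      exact expSeries_div_hasSum_exp s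
    exact h.summable
  refine hexp.congr fun N => ?_
  exact (deriv_weight_succ s N).symm

end Scalar

/-! ## §2. Graded families: tails of any order, for exponential and derivative-type majorants -/

section Graded

variable {𝔸 : Type*} [NormedRing 𝔸]

/-- A graded family majorised by `sᴺ/N!` with sum `P`: `‖P − Σ_{N<n} c(N)‖ ≤ (sⁿ/n!)eˢ`. [folklore] -/
private theorem norm_sub_sum_range_le {c : ℕ → 𝔸} {P : 𝔸} {s : ℝ} (hs : 0 ≤ s) (hsum : HasSum c P)
    (hle : ∀ N, ‖c N‖ ≤ s ^ N / N !) (n : ℕ) :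
    ‖P - ∑ N ∈ range n, c N‖ ≤ s ^ n / n ! * Real.exp s := by
  have hreal0 : Summable fun N : ℕ => s ^ N / N ! := by
    have h : HasSum (fun k : ℕ => s ^ k / k !) (Real.exp s) := by
      rw [Real.exp_eq_exp_ℝ]
      exact expSeries_div_hasSum_exp s
    exact h.summable
  have hnorm : Summable fun N => ‖c N‖ := Summable.of_nonneg_of_le (fun _ => norm_nonneg _) hle hreal0
  have htail : HasSum (fun N => c (N + n)) (P - ∑ N ∈ range n, c N) := (hasSum_nat_add_iff' n).mpr hsum
  rw [← htail.tsum_eq]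
  have hnorm' : Summable fun N => ‖c (N + n)‖ := (summable_nat_add_iff n).mpr hnorm
  have hreal : Summable fun N : ℕ => s ^ (N + n) / (N + n)! := (hasSum_exp_tail_gen s n).summable
  calc ‖∑' N, c (N + n)‖ ≤ ∑' N, ‖c (N + n)‖ := norm_tsum_le_tsum_norm hnorm'
    _ ≤ ∑' N : ℕ, s ^ (N + n) / (N + n)! := Summable.tsum_le_tsum (fun N => hle (N + n)) hnorm' hreal
    _ ≤ s ^ n / n ! * Real.exp s := exp_tail_le_gen hs n

/-- A graded family majorised by the derivative-type weights `η·N·s^{N−1}/N!` with sum `P`: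
`‖P − Σ_{N≤k} c(N)‖ ≤ η·(sᵏ/k!)eˢ`. [folklore] -/
private theorem norm_sub_sum_range_le_deriv {c : ℕ → 𝔸} {P : 𝔸} {s η : ℝ} (hs : 0 ≤ s) (hη : 0 ≤ η)
    (hsum : HasSum c P) (hle : ∀ N, ‖c N‖ ≤ η * ((N : ℝ) * s ^ (N - 1) / N !)) (k : ℕ) :
    ‖P - ∑ N ∈ range (k + 1), c N‖ ≤ η * (s ^ k / k ! * Real.exp s) := by
  have hreal0 : Summable fun N : ℕ => η * ((N : ℝ) * s ^ (N - 1) / N !) :=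
    (summable_deriv_weight s).mul_left η
  have hnorm : Summable fun N => ‖c N‖ := Summable.of_nonneg_of_le (fun _ => norm_nonneg _) hle hreal0
  have htail : HasSum (fun N => c (N + (k + 1))) (P - ∑ N ∈ range (k + 1), c N) :=
    (hasSum_nat_add_iff' (k + 1)).mpr hsum
  rw [← htail.tsum_eq]
  have hnorm' : Summable fun N => ‖c (N + (k + 1))‖ := (summable_nat_add_iff (k + 1)).mpr hnorm
  have hreal : Summable fun N : ℕ => η * (s ^ (N + k) / (N + k)!) :=
    (hasSum_exp_tail_gen s k).summable.mul_left η
  have hterm : ∀ N : ℕ, η * (((N + (k + 1) : ℕ) : ℝ) * s ^ (N + (k + 1) - 1) / (N + (k + 1))!)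
      = η * (s ^ (N + k) / (N + k)!) := by
    intro N
    rw [show N + (k + 1) = (N + k) + 1 by ring, deriv_weight_succ]
  calc ‖∑' N, c (N + (k + 1))‖ ≤ ∑' N, ‖c (N + (k + 1))‖ := norm_tsum_le_tsum_norm hnorm'
    _ ≤ ∑' N : ℕ, η * (s ^ (N + k) / (N + k)!) := by
        refine Summable.tsum_le_tsum (fun N => ?_) hnorm' hreal
        rw [← hterm N]
        exact hle _
    _ = η * ∑' N : ℕ, s ^ (N + k) / (N + k)! := tsum_mul_left
    _ ≤ η * (s ^ k / k ! * Real.exp s) := mul_le_mul_of_nonneg_left (exp_tail_le_gen hs k) hη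

/-- `Σ_{k+l=N} uᵏ/k! · (l·v^{l−1}/l!) = N(u + v)^{N−1}/N!` (the `v`-derivative of the binomial identity). [folklore] -/
private theorem sum_antidiagonal_deriv_right (u v : ℝ) (N : ℕ) :
    ∑ kl ∈ antidiagonal N, u ^ kl.1 / kl.1 ! * ((kl.2 : ℝ) * v ^ (kl.2 - 1) / kl.2 !)
      = (N : ℝ) * (u + v) ^ (N - 1) / N ! := by
  cases N with
  | zero => simp
  | succ n =>
    rw [Finset.Nat.sum_antidiagonal_succ']
    have h0 : u ^ (n + 1) / (n + 1)! * (((0 : ℕ) : ℝ) * v ^ (0 - 1) / (0 : ℕ)!) = 0 := by simp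
    rw [h0, zero_add]
    have hterm : ∀ kl : ℕ × ℕ, u ^ kl.1 / kl.1 ! * (((kl.2 + 1 : ℕ) : ℝ) * v ^ (kl.2 + 1 - 1) / (kl.2 + 1)!)
        = u ^ kl.1 / kl.1 ! * (v ^ kl.2 / kl.2 !) := by
      intro kl
      rw [deriv_weight_succ]
    simp_rw [hterm]
    rw [sum_antidiagonal_pow_div_factorial, deriv_weight_succ]

/-- `Σ_{k+l=N} (k·u^{k−1}/k!) · vˡ/l! = N(u + v)^{N−1}/N!` (the `u`-derivative of the binomial identity). [folklore] -/
private theorem sum_antidiagonal_deriv_left (u v : ℝ) (N : ℕ) :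
    ∑ kl ∈ antidiagonal N, ((kl.1 : ℝ) * u ^ (kl.1 - 1) / kl.1 !) * (v ^ kl.2 / kl.2 !)
      = (N : ℝ) * (u + v) ^ (N - 1) / N ! := by
  cases N with
  | zero => simp
  | succ n =>
    rw [Finset.Nat.sum_antidiagonal_succ]
    have h0 : (((0 : ℕ) : ℝ) * u ^ (0 - 1) / (0 : ℕ)!) * (v ^ (n + 1) / (n + 1)!) = 0 := by simp
    rw [h0, zero_add]
    have hterm : ∀ kl : ℕ × ℕ, (((kl.1 + 1 : ℕ) : ℝ) * u ^ (kl.1 + 1 - 1) / (kl.1 + 1)!) * (v ^ kl.2 / kl.2 !)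
        = u ^ kl.1 / kl.1 ! * (v ^ kl.2 / kl.2 !) := by
      intro kl
      rw [deriv_weight_succ]
    simp_rw [hterm]
    rw [sum_antidiagonal_pow_div_factorial, deriv_weight_succ]

/-- Cauchy product with a derivative-type majorant on the right: `‖f k‖ ≤ uᵏ/k!`, `‖g l‖ ≤ η·l·v^{l−1}/l!` give
`‖(f ⋆ g)(N)‖ ≤ η·N(u + v)^{N−1}/N!`. [folklore] -/
private theorem norm_cauchy_le_deriv_right {f g : ℕ → 𝔸} {u v η : ℝ} (hf : ∀ k, ‖f k‖ ≤ u ^ k / k !)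
    (hg : ∀ l, ‖g l‖ ≤ η * ((l : ℝ) * v ^ (l - 1) / l !)) (N : ℕ) :
    ‖cauchy f g N‖ ≤ η * ((N : ℝ) * (u + v) ^ (N - 1) / N !) := by
  rw [cauchy_apply]
  calc ‖∑ kl ∈ antidiagonal N, f kl.1 * g kl.2‖ ≤ ∑ kl ∈ antidiagonal N, ‖f kl.1 * g kl.2‖ := norm_sum_le _ _
    _ ≤ ∑ kl ∈ antidiagonal N, u ^ kl.1 / kl.1 ! * (η * ((kl.2 : ℝ) * v ^ (kl.2 - 1) / kl.2 !)) := by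
        refine Finset.sum_le_sum fun kl _ => (norm_mul_le _ _).trans ?_
        exact mul_le_mul (hf _) (hg _) (norm_nonneg _) ((norm_nonneg _).trans (hf _))
    _ = η * ∑ kl ∈ antidiagonal N, u ^ kl.1 / kl.1 ! * ((kl.2 : ℝ) * v ^ (kl.2 - 1) / kl.2 !) := by
        rw [Finset.mul_sum]
        refine Finset.sum_congr rfl fun kl _ => ?_
        ring
    _ = η * ((N : ℝ) * (u + v) ^ (N - 1) / N !) := by rw [sum_antidiagonal_deriv_right]

/-- Cauchy product with a derivative-type majorant on the left: `‖f k‖ ≤ η·k·u^{k−1}/k!`, `‖g l‖ ≤ vˡ/l!` give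
`‖(f ⋆ g)(N)‖ ≤ η·N(u + v)^{N−1}/N!`. [folklore] -/
private theorem norm_cauchy_le_deriv_left {f g : ℕ → 𝔸} {u v η : ℝ} (hf : ∀ k, ‖f k‖ ≤ η * ((k : ℝ) * u ^ (k - 1) / k !))
    (hg : ∀ l, ‖g l‖ ≤ v ^ l / l !) (N : ℕ) :
    ‖cauchy f g N‖ ≤ η * ((N : ℝ) * (u + v) ^ (N - 1) / N !) := by
  rw [cauchy_apply]
  calc ‖∑ kl ∈ antidiagonal N, f kl.1 * g kl.2‖ ≤ ∑ kl ∈ antidiagonal N, ‖f kl.1 * g kl.2‖ := norm_sum_le _ _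
    _ ≤ ∑ kl ∈ antidiagonal N, (η * ((kl.1 : ℝ) * u ^ (kl.1 - 1) / kl.1 !)) * (v ^ kl.2 / kl.2 !) := by
        refine Finset.sum_le_sum fun kl _ => (norm_mul_le _ _).trans ?_
        exact mul_le_mul (hf _) (hg _) (norm_nonneg _) ((norm_nonneg _).trans (hf _))
    _ = η * ∑ kl ∈ antidiagonal N, ((kl.1 : ℝ) * u ^ (kl.1 - 1) / kl.1 !) * (v ^ kl.2 / kl.2 !) := by
        rw [Finset.mul_sum]
        refine Finset.sum_congr rfl fun kl _ => ?_
        ring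
    _ = η * ((N : ℝ) * (u + v) ^ (N - 1) / N !) := by rw [sum_antidiagonal_deriv_left]

/-- The Cauchy product is additive in its left factor: `(f − f′) ⋆ g = f ⋆ g − f′ ⋆ g`. [folklore] -/
private theorem cauchy_sub_left (f f' g : ℕ → 𝔸) : cauchy (f - f') g = cauchy f g - cauchy f' g := by
  funext N
  simp [cauchy_apply, sub_mul, Finset.sum_sub_distrib]

/-- The Cauchy product is additive in its right factor: `f ⋆ (g − g′) = f ⋆ g − f ⋆ g′`. [folklore] -/
private theorem cauchy_sub_right (f g g' : ℕ → 𝔸) : cauchy f (g - g') = cauchy f g - cauchy f g' := by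
  funext N
  simp [cauchy_apply, mul_sub, Finset.sum_sub_distrib]

end Graded

/-! ## §3. Perturbing one exponent of `e^{Y₁}e^{Y₂}e^{Y₃}e^{Y₄}`: the graded components are Lipschitz with
derivative-type weights -/

section Perturb

variable {𝔸 : Type*} [NormedRing 𝔸] [NormedAlgebra ℝ 𝔸] [NormOneClass 𝔸]

omit [NormedAlgebra ℝ 𝔸] in
/-- `‖Yᵏ − Y′ᵏ‖ ≤ k·m^{k−1}‖Y − Y′‖` for `‖Y‖, ‖Y′‖ ≤ m` (telescoping, no commutativity). [folklore] -/
private theorem norm_pow_sub_pow_le_of_le {Y Y' : 𝔸} {m : ℝ} (hY : ‖Y‖ ≤ m) (hY' : ‖Y'‖ ≤ m) (k : ℕ) :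
    ‖Y ^ k - Y' ^ k‖ ≤ (k : ℝ) * m ^ (k - 1) * ‖Y - Y'‖ := by
  have hm : 0 ≤ m := (norm_nonneg _).trans hY
  induction k with
  | zero => simp
  | succ k ih =>
    have hsplit : Y ^ (k + 1) - Y' ^ (k + 1) = Y ^ k * (Y - Y') + (Y ^ k - Y' ^ k) * Y' := by
      rw [pow_succ, pow_succ]; noncomm_ring
    rw [hsplit, Nat.add_sub_cancel]
    have hYk : ‖Y ^ k‖ ≤ m ^ k := (norm_pow_le Y k).trans (pow_le_pow_left₀ (norm_nonneg _) hY k)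
    have h1 : ‖Y ^ k * (Y - Y')‖ ≤ m ^ k * ‖Y - Y'‖ :=
      (norm_mul_le _ _).trans (mul_le_mul_of_nonneg_right hYk (norm_nonneg _))
    have h2 : ‖(Y ^ k - Y' ^ k) * Y'‖ ≤ (k : ℝ) * m ^ (k - 1) * ‖Y - Y'‖ * m :=
      (norm_mul_le _ _).trans (mul_le_mul ih hY' (norm_nonneg _)
        (by have := norm_nonneg (Y - Y'); positivity))
    have h3 : (k : ℝ) * m ^ (k - 1) * ‖Y - Y'‖ * m ≤ (k : ℝ) * m ^ k * ‖Y - Y'‖ := by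
      cases k with
      | zero => simp
      | succ k =>
        rw [Nat.add_sub_cancel, pow_succ]
        have := norm_nonneg (Y - Y')
        nlinarith [pow_nonneg hm k]
    calc ‖Y ^ k * (Y - Y') + (Y ^ k - Y' ^ k) * Y'‖ ≤ ‖Y ^ k * (Y - Y')‖ + ‖(Y ^ k - Y' ^ k) * Y'‖ :=
          norm_add_le _ _
      _ ≤ m ^ k * ‖Y - Y'‖ + (k : ℝ) * m ^ k * ‖Y - Y'‖ := add_le_add h1 (h2.trans h3)
      _ = ((k + 1 : ℕ) : ℝ) * m ^ k * ‖Y - Y'‖ := by push_cast; ring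

/-- The exponential-series terms are Lipschitz with the derivative-type weights:
`‖Yᵏ/k! − Y′ᵏ/k!‖ ≤ ‖Y − Y′‖·k·m^{k−1}/k!`. [folklore] -/
private theorem norm_eTerm_sub_le {Y Y' : 𝔸} {m : ℝ} (hY : ‖Y‖ ≤ m) (hY' : ‖Y'‖ ≤ m) (k : ℕ) :
    ‖eTerm Y k - eTerm Y' k‖ ≤ ‖Y - Y'‖ * ((k : ℝ) * m ^ (k - 1) / k !) := by
  rw [eTerm_apply, eTerm_apply, ← smul_sub, norm_smul, norm_inv, Real.norm_natCast]
  have h := norm_pow_sub_pow_le_of_le hY hY' k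
  have hk : (0 : ℝ) < k ! := by positivity
  calc (↑k !)⁻¹ * ‖Y ^ k - Y' ^ k‖ ≤ (↑k !)⁻¹ * ((k : ℝ) * m ^ (k - 1) * ‖Y - Y'‖) :=
        mul_le_mul_of_nonneg_left h (by positivity)
    _ = ‖Y - Y'‖ * ((k : ℝ) * m ^ (k - 1) / k !) := by
        field_simp

/-- **Perturbing the third exponent**: for `‖Yᵢ‖, ‖Y₃′‖ ≤ m`,
`‖grade4(Y₁,Y₂,Y₃,Y₄)(N) − grade4(Y₁,Y₂,Y₃′,Y₄)(N)‖ ≤ ‖Y₃ − Y₃′‖·N(4m)^{N−1}/N!`. [folklore] -/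
private theorem norm_grade4_sub_third_le {Y₁ Y₂ Y₃ Y₃' Y₄ : 𝔸} {m : ℝ} (h₁ : ‖Y₁‖ ≤ m) (h₂ : ‖Y₂‖ ≤ m)
    (h₃ : ‖Y₃‖ ≤ m) (h₃' : ‖Y₃'‖ ≤ m) (h₄ : ‖Y₄‖ ≤ m) (N : ℕ) :
    ‖grade4 Y₁ Y₂ Y₃ Y₄ N - grade4 Y₁ Y₂ Y₃' Y₄ N‖ ≤ ‖Y₃ - Y₃'‖ * ((N : ℝ) * (4 * m) ^ (N - 1) / N !) := by
  have hdiff : grade4 Y₁ Y₂ Y₃ Y₄ N - grade4 Y₁ Y₂ Y₃' Y₄ N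
      = cauchy (cauchy (cauchy (eTerm Y₁) (eTerm Y₂)) (eTerm Y₃ - eTerm Y₃')) (eTerm Y₄) N := by
    rw [grade4_def, grade4_def, cauchy_sub_right, cauchy_sub_left, Pi.sub_apply]
  rw [hdiff]
  have h12 : ∀ k, ‖cauchy (eTerm Y₁) (eTerm Y₂) k‖ ≤ (m + m) ^ k / k ! :=
    norm_cauchy_le (norm_eTerm_le h₁) (norm_eTerm_le h₂)
  have hd : ∀ l, ‖(eTerm Y₃ - eTerm Y₃') l‖ ≤ ‖Y₃ - Y₃'‖ * ((l : ℝ) * m ^ (l - 1) / l !) := fun l => by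
    rw [Pi.sub_apply]; exact norm_eTerm_sub_le h₃ h₃' l
  have h123 := norm_cauchy_le_deriv_right h12 hd
  have h1234 := norm_cauchy_le_deriv_left h123 (norm_eTerm_le h₄) N
  have hm : m + m + m + m = 4 * m := by ring
  rw [hm] at h1234
  exact h1234

/-- **Perturbing the fourth exponent**: for `‖Yᵢ‖, ‖Y₄′‖ ≤ m`,
`‖grade4(Y₁,Y₂,Y₃,Y₄)(N) − grade4(Y₁,Y₂,Y₃,Y₄′)(N)‖ ≤ ‖Y₄ − Y₄′‖·N(4m)^{N−1}/N!`. [folklore] -/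
private theorem norm_grade4_sub_fourth_le {Y₁ Y₂ Y₃ Y₄ Y₄' : 𝔸} {m : ℝ} (h₁ : ‖Y₁‖ ≤ m) (h₂ : ‖Y₂‖ ≤ m)
    (h₃ : ‖Y₃‖ ≤ m) (h₄ : ‖Y₄‖ ≤ m) (h₄' : ‖Y₄'‖ ≤ m) (N : ℕ) :
    ‖grade4 Y₁ Y₂ Y₃ Y₄ N - grade4 Y₁ Y₂ Y₃ Y₄' N‖ ≤ ‖Y₄ - Y₄'‖ * ((N : ℝ) * (4 * m) ^ (N - 1) / N !) := by
  have hdiff : grade4 Y₁ Y₂ Y₃ Y₄ N - grade4 Y₁ Y₂ Y₃ Y₄' N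
      = cauchy (cauchy (cauchy (eTerm Y₁) (eTerm Y₂)) (eTerm Y₃)) (eTerm Y₄ - eTerm Y₄') N := by
    rw [grade4_def, grade4_def, cauchy_sub_right, Pi.sub_apply]
  rw [hdiff]
  have h123 : ∀ k, ‖cauchy (cauchy (eTerm Y₁) (eTerm Y₂)) (eTerm Y₃) k‖ ≤ (m + m + m) ^ k / k ! :=
    norm_cauchy_le (norm_cauchy_le (norm_eTerm_le h₁) (norm_eTerm_le h₂)) (norm_eTerm_le h₃)
  have hd : ∀ l, ‖(eTerm Y₄ - eTerm Y₄') l‖ ≤ ‖Y₄ - Y₄'‖ * ((l : ℝ) * m ^ (l - 1) / l !) := fun l => by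
    rw [Pi.sub_apply]; exact norm_eTerm_sub_le h₄ h₄' l
  have h1234 := norm_cauchy_le_deriv_right h123 hd N
  have hm : m + m + m + m = 4 * m := by ring
  rw [hm] at h1234
  exact h1234

/-- **Perturbing the third and fourth exponents at once, all degrees ≥ n summed**: with
`c(N) = grade4(Y)(N) − grade4(Y′)(N)`, `Y′ = (Y₁, Y₂, Y₃′, Y₄′)`, all norms `≤ m`, `s = 4m`,
`‖[ΠeʸⁱΠ-part of degree ≥ k+1] − [same for Y′]‖ ≤ (‖Y₃ − Y₃′‖ + ‖Y₄ − Y₄′‖)·(sᵏ/k!)eˢ`. [folklore] -/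
private theorem norm_fourExp_sub_fourExp_tail_le [CompleteSpace 𝔸] {Y₁ Y₂ Y₃ Y₃' Y₄ Y₄' : 𝔸} {m : ℝ}
    (h₁ : ‖Y₁‖ ≤ m) (h₂ : ‖Y₂‖ ≤ m) (h₃ : ‖Y₃‖ ≤ m) (h₃' : ‖Y₃'‖ ≤ m) (h₄ : ‖Y₄‖ ≤ m) (h₄' : ‖Y₄'‖ ≤ m)
    (k : ℕ) :
    ‖(exp Y₁ * exp Y₂ * exp Y₃ * exp Y₄ - exp Y₁ * exp Y₂ * exp Y₃' * exp Y₄')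
        - ∑ N ∈ range (k + 1), (grade4 Y₁ Y₂ Y₃ Y₄ N - grade4 Y₁ Y₂ Y₃' Y₄' N)‖
      ≤ (‖Y₃ - Y₃'‖ + ‖Y₄ - Y₄'‖) * ((4 * m) ^ k / k ! * Real.exp (4 * m)) := by
  have hm : 0 ≤ m := (norm_nonneg _).trans h₁
  have hsum : HasSum (fun N => grade4 Y₁ Y₂ Y₃ Y₄ N - grade4 Y₁ Y₂ Y₃' Y₄' N)
      (exp Y₁ * exp Y₂ * exp Y₃ * exp Y₄ - exp Y₁ * exp Y₂ * exp Y₃' * exp Y₄') :=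
    (hasSum_grade4 Y₁ Y₂ Y₃ Y₄).sub (hasSum_grade4 Y₁ Y₂ Y₃' Y₄')
  have hle : ∀ N, ‖grade4 Y₁ Y₂ Y₃ Y₄ N - grade4 Y₁ Y₂ Y₃' Y₄' N‖
      ≤ (‖Y₃ - Y₃'‖ + ‖Y₄ - Y₄'‖) * ((N : ℝ) * (4 * m) ^ (N - 1) / N !) := by
    intro N
    have hA := norm_grade4_sub_third_le h₁ h₂ h₃ h₃' h₄ N
    have hB := norm_grade4_sub_fourth_le h₁ h₂ h₃' h₄ h₄' N
    have hsplit : grade4 Y₁ Y₂ Y₃ Y₄ N - grade4 Y₁ Y₂ Y₃' Y₄' N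
        = (grade4 Y₁ Y₂ Y₃ Y₄ N - grade4 Y₁ Y₂ Y₃' Y₄ N) + (grade4 Y₁ Y₂ Y₃' Y₄ N - grade4 Y₁ Y₂ Y₃' Y₄' N) := by
      abel
    rw [hsplit]
    refine (norm_add_le _ _).trans ?_
    rw [add_mul]
    exact add_le_add hA hB
  exact norm_sub_sum_range_le_deriv (by positivity) (by positivity) hsum hle k

end Perturb

/-! ## §4. The degree-4 component of `e^{Y₁}e^{Y₂}e^{Y₃}e^{Y₄}` and its trace at `Y₃ = −Y₁`, `Y₄ = −Y₂` -/

section Degree4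

variable {R : Type*} [Ring R]

/-- `Σ_{i<j}[Yᵢ, Yⱼ] − 2[Y₄, Y₁]` is of THIRD order when `Y₁ + Y₃`, `Y₂ + Y₄` are of second order: written through
`δ₁ = Y₁ + Y₃`, `δ₂ = Y₂ + Y₄` it is `[Y₁, δ₁] + 2[Y₂, δ₁] + [Y₂, δ₂] + [δ₁, δ₂] + 2[Y₁, δ₂]`. [folklore] -/
private theorem comm2_sub_two_lie_eq (Y₁ Y₂ Y₃ Y₄ : R) :
    comm2 Y₁ Y₂ Y₃ Y₄ - 2 * ⁅Y₄, Y₁⁆ = ⁅Y₁, Y₁ + Y₃⁆ + 2 * ⁅Y₂, Y₁ + Y₃⁆ + ⁅Y₂, Y₂ + Y₄⁆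
      + ⁅Y₁ + Y₃, Y₂ + Y₄⁆ + 2 * ⁅Y₁, Y₂ + Y₄⁆ := by
  simp only [comm2, Ring.lie_def]
  noncomm_ring

end Degree4

section Degree4Normed

variable {𝔸 : Type*} [NormedRing 𝔸] [NormedAlgebra ℝ 𝔸]

/-- **Degree 4 of `e^{Y₁}e^{Y₂}e^{Y₃}e^{Y₄}`** (the term of [B11] (34)/(35) after `prod3`): `24·grade4 4` is the sum of
the 35 ordered monomials `Y₁^{n₁}Y₂^{n₂}Y₃^{n₃}Y₄^{n₄}`, `Σnᵢ = 4`, with the multinomial weights `24/(n₁!n₂!n₃!n₄!)`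
(the triple Cauchy product of the four exponential series at total degree 4).
[cite: Balaban1985Variational, (34)-(35) p.283] -/
theorem twentyfour_smul_grade4_four (Y₁ Y₂ Y₃ Y₄ : 𝔸) :
    (24 : ℝ) • grade4 Y₁ Y₂ Y₃ Y₄ 4 =
      (Y₁ * Y₁ * Y₁ * Y₁ + Y₂ * Y₂ * Y₂ * Y₂ + Y₃ * Y₃ * Y₃ * Y₃ + Y₄ * Y₄ * Y₄ * Y₄)
      + 4 * ((Y₁ * Y₁ * Y₁ * Y₂ + Y₁ * Y₂ * Y₂ * Y₂) + (Y₁ * Y₁ * Y₁ * Y₃ + Y₁ * Y₃ * Y₃ * Y₃)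
          + (Y₁ * Y₁ * Y₁ * Y₄ + Y₁ * Y₄ * Y₄ * Y₄) + (Y₂ * Y₂ * Y₂ * Y₃ + Y₂ * Y₃ * Y₃ * Y₃)
          + (Y₂ * Y₂ * Y₂ * Y₄ + Y₂ * Y₄ * Y₄ * Y₄) + (Y₃ * Y₃ * Y₃ * Y₄ + Y₃ * Y₄ * Y₄ * Y₄))
      + 6 * (Y₁ * Y₁ * Y₂ * Y₂ + Y₁ * Y₁ * Y₃ * Y₃ + Y₁ * Y₁ * Y₄ * Y₄ + Y₂ * Y₂ * Y₃ * Y₃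
          + Y₂ * Y₂ * Y₄ * Y₄ + Y₃ * Y₃ * Y₄ * Y₄)
      + 12 * ((Y₁ * Y₁ * Y₂ * Y₃ + Y₁ * Y₂ * Y₂ * Y₃ + Y₁ * Y₂ * Y₃ * Y₃)
          + (Y₁ * Y₁ * Y₂ * Y₄ + Y₁ * Y₂ * Y₂ * Y₄ + Y₁ * Y₂ * Y₄ * Y₄)
          + (Y₁ * Y₁ * Y₃ * Y₄ + Y₁ * Y₃ * Y₃ * Y₄ + Y₁ * Y₃ * Y₄ * Y₄)
          + (Y₂ * Y₂ * Y₃ * Y₄ + Y₂ * Y₃ * Y₃ * Y₄ + Y₂ * Y₃ * Y₄ * Y₄))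
      + 24 * (Y₁ * Y₂ * Y₃ * Y₄) := by
  simp only [grade4_def, cauchy_apply, eTerm_apply, Finset.Nat.sum_antidiagonal_eq_sum_range_succ_mk,
    Finset.sum_range_succ, Finset.sum_range_zero]
  norm_num [Nat.factorial, smul_mul_assoc, mul_smul_comm, smul_smul, smul_add, sq, pow_succ, mul_add, add_mul,
    mul_assoc]
  have e4 : (4 : 𝔸) = (4 : ℝ) • (1 : 𝔸) := by
    rw [show (4 : 𝔸) = ((4 : ℕ) : 𝔸) by norm_num, show (4 : ℝ) = ((4 : ℕ) : ℝ) by norm_num]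
    exact natCast_eq_smul_one 4
  have e6 : (6 : 𝔸) = (6 : ℝ) • (1 : 𝔸) := by
    rw [show (6 : 𝔸) = ((6 : ℕ) : 𝔸) by norm_num, show (6 : ℝ) = ((6 : ℕ) : ℝ) by norm_num]
    exact natCast_eq_smul_one 6
  have e12 : (12 : 𝔸) = (12 : ℝ) • (1 : 𝔸) := by
    rw [show (12 : 𝔸) = ((12 : ℕ) : 𝔸) by norm_num, show (12 : ℝ) = ((12 : ℕ) : ℝ) by norm_num]
    exact natCast_eq_smul_one 12
  have e24 : (24 : 𝔸) = (24 : ℝ) • (1 : 𝔸) := by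
    rw [show (24 : 𝔸) = ((24 : ℕ) : 𝔸) by norm_num, show (24 : ℝ) = ((24 : ℕ) : ℝ) by norm_num]
    exact natCast_eq_smul_one 24
  simp only [e4, e6, e12, e24, smul_mul_assoc, one_mul]
  module

/-- **The degree-4 part of the group commutator `eˣeʸe⁻ˣe⁻ʸ` is `½[X, Y]²` modulo commutators**:
`24·grade4(X, Y, −X, −Y)(4) = 12[X, Y]² + Σ(six commutators)` (numerals inside the brackets, so that a trace kills
each bracket as it stands). [folklore] -/
private theorem twentyfour_smul_grade4_four_neg_neg (X Y : 𝔸) :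
    (24 : ℝ) • grade4 X Y (-X) (-Y) 4 = 12 * (⁅X, Y⁆ * ⁅X, Y⁆)
      + (⁅4 * (X * X * X), Y⁆ + ⁅12 * (X * Y * X), X⁆ + ⁅4 * X, Y * Y * Y⁆ + ⁅12 * Y, Y * X * Y⁆
        + ⁅X * X, (-6) * (Y * Y)⁆ + ⁅12 * X, Y * X * Y⁆) := by
  rw [twentyfour_smul_grade4_four]
  simp only [Ring.lie_def]
  noncomm_ring

/-- Numerals act as real scalars: `n·a = (n : ℝ)•a` in a real normed algebra. [folklore] -/
private theorem ofNat_mul_eq_smul (n : ℕ) [n.AtLeastTwo] (a : 𝔸) :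
    (ofNat(n) : 𝔸) * a = (ofNat(n) : ℝ) • a := by
  rw [← Nat.cast_ofNat (R := 𝔸), ← Nat.cast_ofNat (R := ℝ), natCast_eq_smul_one, smul_mul_assoc, one_mul]

end Degree4Normed

/-! ## §5. The sharpened plaquette expansion: `1 − Re tr Πe^{Yᵢ} = −½Re tr(Z₁ + [Y₄, Y₁])² + O(ε⁵)` when
`Yᵢ = O(ε)` and `Y₁ + Y₃, Y₂ + Y₄ = O(ε²)` -/

section Sharp

variable {𝔸 : Type*} [NormedRing 𝔸] [NormedAlgebra ℂ 𝔸]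

omit [NormedAlgebra ℂ 𝔸] in
/-- `‖[a, b]‖ ≤ 2‖a‖‖b‖`. [folklore] -/
private theorem norm_lie_le_two_mul (a b : 𝔸) : ‖⁅a, b⁆‖ ≤ 2 * ‖a‖ * ‖b‖ := by
  rw [Ring.lie_def]
  refine (norm_sub_le _ _).trans ?_
  have h1 := norm_mul_le a b
  have h2 := norm_mul_le b a
  linarith

omit [NormedAlgebra ℂ 𝔸] in
/-- `‖a + b + c + d + e‖ ≤ ‖a‖ + ‖b‖ + ‖c‖ + ‖d‖ + ‖e‖`. [folklore] -/
private theorem norm_add_five_le (a b c d e : 𝔸) : ‖a + b + c + d + e‖ ≤ ‖a‖ + ‖b‖ + ‖c‖ + ‖d‖ + ‖e‖ := by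
  have h1 := norm_add_le (a + b + c + d) e
  have h2 := norm_add_le (a + b + c) d
  have h3 := norm_add_le (a + b) c
  have h4 := norm_add_le a b
  linarith

/-- A trace kills the pair double-commutator sum of the third-order BCH term. [folklore] -/
private theorem trace_comm3pair_eq_zero (τ : 𝔸 →L[ℂ] ℂ) (htr : ∀ a b : 𝔸, τ (a * b) = τ (b * a)) (Y₁ Y₂ Y₃ Y₄ : 𝔸) :
    τ (comm3pair Y₁ Y₂ Y₃ Y₄) = 0 := by
  simp only [comm3pair, map_add, trace_lie_eq_zero τ htr, add_zero]

/-- A trace kills the triple double-commutator sum of the third-order BCH term. [folklore] -/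
private theorem trace_comm3triple_eq_zero (τ : 𝔸 →L[ℂ] ℂ) (htr : ∀ a b : 𝔸, τ (a * b) = τ (b * a)) (Y₁ Y₂ Y₃ Y₄ : 𝔸) :
    τ (comm3triple Y₁ Y₂ Y₃ Y₄) = 0 := by
  simp only [comm3triple, map_add, trace_lie_eq_zero τ htr, add_zero]

/-- `Re τ(n·a) = n·Re τ(a)` for numerals. [folklore] -/
private theorem re_trace_ofNat_mul (τ : 𝔸 →L[ℂ] ℂ) (n : ℕ) [n.AtLeastTwo] (a : 𝔸) :
    (τ ((ofNat(n) : 𝔸) * a)).re = (ofNat(n) : ℝ) * (τ a).re := by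
  rw [ofNat_mul_eq_smul, re_trace_real_smul]

/-- The trace of `prod3`: `Re τ(prod3) = 2Re τ(Z₁³) + 6Re τ(Z₁C)` (the double commutators and `C`'s own trace
drop out; `τ(CZ₁) = τ(Z₁C)`). [folklore] -/
private theorem re_trace_prod3 (τ : 𝔸 →L[ℂ] ℂ) (htr : ∀ a b : 𝔸, τ (a * b) = τ (b * a)) (Y₁ Y₂ Y₃ Y₄ : 𝔸) :
    (τ (prod3 Y₁ Y₂ Y₃ Y₄)).re
      = 2 * (τ (Z1 Y₁ Y₂ Y₃ Y₄ * Z1 Y₁ Y₂ Y₃ Y₄ * Z1 Y₁ Y₂ Y₃ Y₄)).re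
        + 6 * (τ (Z1 Y₁ Y₂ Y₃ Y₄ * comm2 Y₁ Y₂ Y₃ Y₄)).re := by
  rw [bch4_degree3]
  simp only [map_add, Complex.add_re, re_trace_ofNat_mul, trace_comm3pair_eq_zero τ htr,
    trace_comm3triple_eq_zero τ htr, Complex.zero_re, mul_zero, add_zero, mul_add,
    htr (comm2 Y₁ Y₂ Y₃ Y₄) (Z1 Y₁ Y₂ Y₃ Y₄)]
  ring

/-- The trace of the degree-4 component at `Y₃ = −Y₁`, `Y₄ = −Y₂`: `Re τ(grade4 4) = ½Re τ([Y₁, Y₂]²)`.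
[folklore] -/
private theorem re_trace_grade4_four_neg_neg (τ : 𝔸 →L[ℂ] ℂ) (htr : ∀ a b : 𝔸, τ (a * b) = τ (b * a)) (X Y : 𝔸) :
    (τ (grade4 X Y (-X) (-Y) 4)).re = 2⁻¹ * (τ (⁅X, Y⁆ * ⁅X, Y⁆)).re := by
  have h24 : (τ ((24 : ℝ) • grade4 X Y (-X) (-Y) 4)).re = 24 * (τ (grade4 X Y (-X) (-Y) 4)).re :=
    re_trace_real_smul τ 24 _
  rw [twentyfour_smul_grade4_four_neg_neg] at h24
  simp only [map_add, trace_lie_eq_zero τ htr, add_zero, re_trace_ofNat_mul] at h24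
  linarith

variable [NormOneClass 𝔸] [CompleteSpace 𝔸]

omit [NormOneClass 𝔸] [CompleteSpace 𝔸] in
/-- `‖Σ_{i<j}[Yᵢ, Yⱼ] − 2[Y₄, Y₁]‖ ≤ 12ε₁ε₂ + 2ε₂²` for `‖Yᵢ‖ ≤ ε₁`, `‖Y₁ + Y₃‖, ‖Y₂ + Y₄‖ ≤ ε₂`
(from `comm2_sub_two_lie_eq`). [folklore] -/
private theorem norm_comm2_sub_two_lie_le {Y₁ Y₂ Y₃ Y₄ : 𝔸} {ε₁ ε₂ : ℝ} (h₁ : ‖Y₁‖ ≤ ε₁) (h₂ : ‖Y₂‖ ≤ ε₁)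
    (hδ₁ : ‖Y₁ + Y₃‖ ≤ ε₂) (hδ₂ : ‖Y₂ + Y₄‖ ≤ ε₂) :
    ‖comm2 Y₁ Y₂ Y₃ Y₄ - 2 * ⁅Y₄, Y₁⁆‖ ≤ 12 * ε₁ * ε₂ + 2 * ε₂ ^ 2 := by
  have hε₁ : 0 ≤ ε₁ := (norm_nonneg _).trans h₁
  have hε₂ : 0 ≤ ε₂ := (norm_nonneg _).trans hδ₁
  rw [comm2_sub_two_lie_eq]
  have n2 : ∀ a : 𝔸, ‖(2 : 𝔸) * a‖ ≤ 2 * ‖a‖ := fun a => by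
    rw [ofNat_mul_eq_smul, norm_smul, Real.norm_ofNat]
  have hn13 := norm_nonneg (Y₁ + Y₃)
  have hn24 := norm_nonneg (Y₂ + Y₄)
  have m1 : ‖Y₁‖ * ‖Y₁ + Y₃‖ ≤ ε₁ * ε₂ := mul_le_mul h₁ hδ₁ hn13 hε₁
  have m2 : ‖Y₂‖ * ‖Y₁ + Y₃‖ ≤ ε₁ * ε₂ := mul_le_mul h₂ hδ₁ hn13 hε₁
  have m3 : ‖Y₂‖ * ‖Y₂ + Y₄‖ ≤ ε₁ * ε₂ := mul_le_mul h₂ hδ₂ hn24 hε₁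
  have m4 : ‖Y₁ + Y₃‖ * ‖Y₂ + Y₄‖ ≤ ε₂ * ε₂ := mul_le_mul hδ₁ hδ₂ hn24 hε₂
  have m5 : ‖Y₁‖ * ‖Y₂ + Y₄‖ ≤ ε₁ * ε₂ := mul_le_mul h₁ hδ₂ hn24 hε₁
  have b1 := norm_lie_le_two_mul Y₁ (Y₁ + Y₃)
  have b2 := norm_lie_le_two_mul Y₂ (Y₁ + Y₃)
  have b3 := norm_lie_le_two_mul Y₂ (Y₂ + Y₄)
  have b4 := norm_lie_le_two_mul (Y₁ + Y₃) (Y₂ + Y₄)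
  have b5 := norm_lie_le_two_mul Y₁ (Y₂ + Y₄)
  have c2 := n2 ⁅Y₂, Y₁ + Y₃⁆
  have c5 := n2 ⁅Y₁, Y₂ + Y₄⁆
  rw [mul_assoc] at b1 b2 b3 b4 b5
  have h5 := norm_add_five_le ⁅Y₁, Y₁ + Y₃⁆ (2 * ⁅Y₂, Y₁ + Y₃⁆) ⁅Y₂, Y₂ + Y₄⁆ ⁅Y₁ + Y₃, Y₂ + Y₄⁆
    (2 * ⁅Y₁, Y₂ + Y₄⁆)
  have hsq : ε₂ ^ 2 = ε₂ * ε₂ := pow_two ε₂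
  rw [hsq]
  linarith

omit [NormedAlgebra ℂ 𝔸] [NormOneClass 𝔸] [CompleteSpace 𝔸] in
/-- `‖[Y₄, Y₁]² − [Y₁, Y₂]²‖ ≤ 8ε₁³ε₂` for `‖Yᵢ‖ ≤ ε₁`, `‖Y₂ + Y₄‖ ≤ ε₂` (`[Y₄, Y₁] − [Y₁, Y₂] = [Y₂ + Y₄, Y₁]`).
[folklore] -/
private theorem norm_lie_sq_sub_lie_sq_le {Y₁ Y₂ Y₄ : 𝔸} {ε₁ ε₂ : ℝ} (h₁ : ‖Y₁‖ ≤ ε₁) (h₂ : ‖Y₂‖ ≤ ε₁)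
    (h₄ : ‖Y₄‖ ≤ ε₁) (hδ₂ : ‖Y₂ + Y₄‖ ≤ ε₂) :
    ‖⁅Y₄, Y₁⁆ * ⁅Y₄, Y₁⁆ - ⁅Y₁, Y₂⁆ * ⁅Y₁, Y₂⁆‖ ≤ 8 * ε₁ ^ 3 * ε₂ := by
  have hε₁ : 0 ≤ ε₁ := (norm_nonneg _).trans h₁
  have hε₂ : 0 ≤ ε₂ := (norm_nonneg _).trans hδ₂
  have hKn : ‖⁅Y₄, Y₁⁆‖ ≤ 2 * (ε₁ * ε₁) := by
    have m := mul_le_mul h₄ h₁ (norm_nonneg _) hε₁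
    have b := norm_lie_le_two_mul Y₄ Y₁
    rw [mul_assoc] at b
    exact b.trans (by linarith)
  have hK₀n : ‖⁅Y₁, Y₂⁆‖ ≤ 2 * (ε₁ * ε₁) := by
    have m := mul_le_mul h₁ h₂ (norm_nonneg _) hε₁
    have b := norm_lie_le_two_mul Y₁ Y₂
    rw [mul_assoc] at b
    exact b.trans (by linarith)
  have hKK₀ : ‖⁅Y₄, Y₁⁆ - ⁅Y₁, Y₂⁆‖ ≤ 2 * (ε₂ * ε₁) := by
    have : ⁅Y₄, Y₁⁆ - ⁅Y₁, Y₂⁆ = ⁅Y₂ + Y₄, Y₁⁆ := by simp only [Ring.lie_def]; noncomm_ring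
    rw [this]
    have m := mul_le_mul hδ₂ h₁ (norm_nonneg _) hε₂
    have b := norm_lie_le_two_mul (Y₂ + Y₄) Y₁
    rw [mul_assoc] at b
    exact b.trans (by linarith)
  have hsplit : ⁅Y₄, Y₁⁆ * ⁅Y₄, Y₁⁆ - ⁅Y₁, Y₂⁆ * ⁅Y₁, Y₂⁆
      = ⁅Y₄, Y₁⁆ * (⁅Y₄, Y₁⁆ - ⁅Y₁, Y₂⁆) + (⁅Y₄, Y₁⁆ - ⁅Y₁, Y₂⁆) * ⁅Y₁, Y₂⁆ := by noncomm_ring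
  rw [hsplit]
  refine (norm_add_le _ _).trans ?_
  have a1 := (norm_mul_le ⁅Y₄, Y₁⁆ (⁅Y₄, Y₁⁆ - ⁅Y₁, Y₂⁆)).trans
    (mul_le_mul hKn hKK₀ (norm_nonneg _) (by positivity))
  have a2 := (norm_mul_le (⁅Y₄, Y₁⁆ - ⁅Y₁, Y₂⁆) ⁅Y₁, Y₂⁆).trans
    (mul_le_mul hKK₀ hK₀n (norm_nonneg _) (by positivity))
  have e : 2 * (ε₁ * ε₁) * (2 * (ε₂ * ε₁)) + 2 * (ε₂ * ε₁) * (2 * (ε₁ * ε₁)) = 8 * ε₁ ^ 3 * ε₂ := by ring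
  linarith

omit [NormOneClass 𝔸] [CompleteSpace 𝔸] in
/-- **The four-exponential product through degree 4, traced**: with `T₅ = Πe^{±}… − Σ_{N<5}` the fifth-order tail at
`(Y₁, Y₂, −Y₁, −Y₂)` and `ΔT` the degree-`≥ 4` difference between the products at `(Y₁, Y₂, Y₃, Y₄)` and at
`(Y₁, Y₂, −Y₁, −Y₂)`, and `Re τ Z₁ = 0`:
`Re τ Πe^{Yᵢ} = 1 + ½Re τ Z₁² + ⅙Re τ Z₁³ + ½Re τ(Z₁C) + ½Re τ[Y₁, Y₂]² + Re τ T₅ + Re τ ΔT`. [folklore] -/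
private theorem re_trace_fourExp_eq (τ : 𝔸 →L[ℂ] ℂ) (htr : ∀ a b : 𝔸, τ (a * b) = τ (b * a)) (hτ1 : τ 1 = 1)
    (Y₁ Y₂ Y₃ Y₄ : 𝔸) (hZ : (τ (Z1 Y₁ Y₂ Y₃ Y₄)).re = 0) :
    (τ (exp Y₁ * exp Y₂ * exp Y₃ * exp Y₄)).re
      = 1 + 2⁻¹ * (τ (Z1 Y₁ Y₂ Y₃ Y₄ * Z1 Y₁ Y₂ Y₃ Y₄)).re
        + (6⁻¹ * (τ (Z1 Y₁ Y₂ Y₃ Y₄ * Z1 Y₁ Y₂ Y₃ Y₄ * Z1 Y₁ Y₂ Y₃ Y₄)).re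
          + 2⁻¹ * (τ (Z1 Y₁ Y₂ Y₃ Y₄ * comm2 Y₁ Y₂ Y₃ Y₄)).re)
        + 2⁻¹ * (τ (⁅Y₁, Y₂⁆ * ⁅Y₁, Y₂⁆)).re
        + (τ (exp Y₁ * exp Y₂ * exp (-Y₁) * exp (-Y₂) - ∑ N ∈ range 5, grade4 Y₁ Y₂ (-Y₁) (-Y₂) N)).re
        + (τ ((exp Y₁ * exp Y₂ * exp Y₃ * exp Y₄ - exp Y₁ * exp Y₂ * exp (-Y₁) * exp (-Y₂))
            - ∑ N ∈ range 4, (grade4 Y₁ Y₂ Y₃ Y₄ N - grade4 Y₁ Y₂ (-Y₁) (-Y₂) N))).re := by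
  have hlow := sum_range_four_grade4 Y₁ Y₂ Y₃ Y₄
  have hfive : ∑ N ∈ range 5, grade4 Y₁ Y₂ (-Y₁) (-Y₂) N
      = ∑ N ∈ range 4, grade4 Y₁ Y₂ (-Y₁) (-Y₂) N + grade4 Y₁ Y₂ (-Y₁) (-Y₂) 4 := Finset.sum_range_succ _ 4
  have hPdecomp : exp Y₁ * exp Y₂ * exp Y₃ * exp Y₄
      = 1 + Z1 Y₁ Y₂ Y₃ Y₄ + (2 : ℝ)⁻¹ • prod2 Y₁ Y₂ Y₃ Y₄ + (12 : ℝ)⁻¹ • prod3 Y₁ Y₂ Y₃ Y₄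
        + grade4 Y₁ Y₂ (-Y₁) (-Y₂) 4
        + (exp Y₁ * exp Y₂ * exp (-Y₁) * exp (-Y₂) - ∑ N ∈ range 5, grade4 Y₁ Y₂ (-Y₁) (-Y₂) N)
        + ((exp Y₁ * exp Y₂ * exp Y₃ * exp Y₄ - exp Y₁ * exp Y₂ * exp (-Y₁) * exp (-Y₂))
            - ∑ N ∈ range 4, (grade4 Y₁ Y₂ Y₃ Y₄ N - grade4 Y₁ Y₂ (-Y₁) (-Y₂) N)) := by
    rw [hfive, ← hlow, Finset.sum_sub_distrib]
    abel
  have hg4 := re_trace_grade4_four_neg_neg τ htr Y₁ Y₂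
  conv_lhs => rw [hPdecomp]
  simp only [map_add, Complex.add_re, hτ1, Complex.one_re, hZ, add_zero, re_trace_real_smul, hg4]
  rw [bch4_degree2, map_add, Complex.add_re, trace_comm2_eq_zero τ htr, Complex.zero_re, add_zero,
    re_trace_prod3 τ htr]
  ring

/-- **The plaquette expansion to the order needed by (3.66)**, abstract form.  Let `τ` be a normalized trace
(tracial, `τ 1 = 1`, `|τ a| ≤ ‖a‖`), `‖Yᵢ‖ ≤ ε₁` (`4ε₁ ≤ 1`), `‖Y₁ + Y₃‖, ‖Y₂ + Y₄‖ ≤ ε₂` and `Re τ Z₁ = 0`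
(`Z₁ = ΣYᵢ`).  Then with `W = Z₁ + [Y₄, Y₁]`:
`|[1 − Re τ(e^{Y₁}e^{Y₂}e^{Y₃}e^{Y₄})] + ½Re τ(W²)| ≤ 4ε₂³ + 12ε₁ε₂² + 68ε₁³ε₂ + 26ε₁⁵`.
Mechanism: degrees 0–3 of the product exactly ([B11] (34): `1 + Z₁ + ½(Z₁² + C) + (1/12)(2Z₁³ + 3(Z₁C + CZ₁) +
P + 2T)`, the trace killing `C`, `P`, `T`; `C − 2[Y₄, Y₁] = O(ε₁ε₂)`), degree 4 at `(Y₁, Y₂, −Y₁, −Y₂)` exactly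
(`½Re τ[Y₁, Y₂]²`) plus the Lipschitz bound of §3 for the whole tail of degree `≥ 4`, and the fifth-order tail.
For the plaquette `Yᵢ = ±iξB`, `W = iξ²F_{μν}(x)` and `−½Re τ W² = ½ξ⁴Re τ F²` (below): this is the expansion
«in the same way as above» behind (3.66). [cite: Balaban1988Convergent, (3.66) p.283] -/
theorem fourExp_re_trace_expansion (τ : 𝔸 →L[ℂ] ℂ) (htr : ∀ a b : 𝔸, τ (a * b) = τ (b * a)) (hτ1 : τ 1 = 1)
    (hτn : ∀ a : 𝔸, ‖τ a‖ ≤ ‖a‖) {Y₁ Y₂ Y₃ Y₄ : 𝔸} {ε₁ ε₂ : ℝ}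
    (h₁ : ‖Y₁‖ ≤ ε₁) (h₂ : ‖Y₂‖ ≤ ε₁) (h₃ : ‖Y₃‖ ≤ ε₁) (h₄ : ‖Y₄‖ ≤ ε₁)
    (hδ₁ : ‖Y₁ + Y₃‖ ≤ ε₂) (hδ₂ : ‖Y₂ + Y₄‖ ≤ ε₂) (hε : 4 * ε₁ ≤ 1)
    (hZ : (τ (Z1 Y₁ Y₂ Y₃ Y₄)).re = 0) :
    |(1 - (τ (exp Y₁ * exp Y₂ * exp Y₃ * exp Y₄)).re)
        + 2⁻¹ * (τ ((Z1 Y₁ Y₂ Y₃ Y₄ + ⁅Y₄, Y₁⁆) ^ 2)).re|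
      ≤ 4 * ε₂ ^ 3 + 12 * ε₁ * ε₂ ^ 2 + 68 * ε₁ ^ 3 * ε₂ + 26 * ε₁ ^ 5 := by
  have hε₁ : 0 ≤ ε₁ := (norm_nonneg _).trans h₁
  have hε₂ : 0 ≤ ε₂ := (norm_nonneg _).trans hδ₁
  have h₃' : ‖-Y₁‖ ≤ ε₁ := by rw [norm_neg]; exact h₁
  have h₄' : ‖-Y₂‖ ≤ ε₁ := by rw [norm_neg]; exact h₂
  rw [re_trace_fourExp_eq τ htr hτ1 Y₁ Y₂ Y₃ Y₄ hZ]
  -- names for the pieces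
  set Z := Z1 Y₁ Y₂ Y₃ Y₄ with hZdef
  set C := comm2 Y₁ Y₂ Y₃ Y₄ with hCdef
  set K := ⁅Y₄, Y₁⁆ with hKdef
  set K₀ := ⁅Y₁, Y₂⁆ with hK₀def
  set T₅ := exp Y₁ * exp Y₂ * exp (-Y₁) * exp (-Y₂) - ∑ N ∈ range 5, grade4 Y₁ Y₂ (-Y₁) (-Y₂) N with hT₅
  set ΔT := (exp Y₁ * exp Y₂ * exp Y₃ * exp Y₄ - exp Y₁ * exp Y₂ * exp (-Y₁) * exp (-Y₂))
      - ∑ N ∈ range 4, (grade4 Y₁ Y₂ Y₃ Y₄ N - grade4 Y₁ Y₂ (-Y₁) (-Y₂) N) with hΔT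
  -- the two tails
  have hΔT_le : ‖ΔT‖ ≤ (‖Y₃ - -Y₁‖ + ‖Y₄ - -Y₂‖) * ((4 * ε₁) ^ 3 / (3 : ℕ)! * Real.exp (4 * ε₁)) :=
    norm_fourExp_sub_fourExp_tail_le h₁ h₂ h₃ h₃' h₄ h₄' 3
  have hT₅_le : ‖T₅‖ ≤ (ε₁ + ε₁ + ε₁ + ε₁) ^ 5 / (5 : ℕ)! * Real.exp (ε₁ + ε₁ + ε₁ + ε₁) :=
    norm_sub_sum_range_le (by positivity) (hasSum_grade4 Y₁ Y₂ (-Y₁) (-Y₂))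
      (norm_grade4_le h₁ h₂ h₃' h₄') 5
  -- the main term and the error identity
  have hW : (τ ((Z + K) ^ 2)).re = (τ (Z * Z)).re + 2 * (τ (Z * K)).re + (τ (K * K)).re := by
    rw [pow_two, add_mul, mul_add, mul_add, map_add, map_add, map_add, htr K Z]
    simp only [Complex.add_re]
    ring
  have hCK : (τ (Z * C)).re - 2 * (τ (Z * K)).re = (τ (Z * (C - 2 * K))).re := by
    rw [mul_sub, map_sub, Complex.sub_re]
    have : Z * (2 * K) = (2 : 𝔸) * (Z * K) := by noncomm_ring
    rw [this, re_trace_ofNat_mul]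
  have hKK : (τ (K * K)).re - (τ (K₀ * K₀)).re = (τ (K * K - K₀ * K₀)).re := by
    rw [map_sub, Complex.sub_re]
  have herr : (1 - (1 + 2⁻¹ * (τ (Z * Z)).re + (6⁻¹ * (τ (Z * Z * Z)).re + 2⁻¹ * (τ (Z * C)).re)
      + 2⁻¹ * (τ (K₀ * K₀)).re + (τ T₅).re + (τ ΔT).re)) + 2⁻¹ * (τ ((Z + K) ^ 2)).re
      = -(6⁻¹ * (τ (Z * Z * Z)).re) - 2⁻¹ * (τ (Z * (C - 2 * K))).re + 2⁻¹ * (τ (K * K - K₀ * K₀)).re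
        - (τ T₅).re - (τ ΔT).re := by
    rw [hW, ← hCK, ← hKK]
    ring
  rw [herr]
  -- norm bounds for the five error terms
  have hZn : ‖Z‖ ≤ 2 * ε₂ := by
    have : Z = (Y₁ + Y₃) + (Y₂ + Y₄) := by rw [hZdef, Z1]; abel
    rw [this]
    exact (norm_add_le _ _).trans (by linarith)
  have e1 : |6⁻¹ * (τ (Z * Z * Z)).re| ≤ 4 / 3 * ε₂ ^ 3 := by
    rw [abs_mul, abs_of_pos (by norm_num : (0 : ℝ) < 6⁻¹)]
    have hZ3 : ‖Z * Z * Z‖ ≤ (2 * ε₂) * (2 * ε₂) * (2 * ε₂) := by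
      have hZ0 := norm_nonneg Z
      calc ‖Z * Z * Z‖ ≤ ‖Z‖ * ‖Z‖ * ‖Z‖ := (norm_mul_le _ _).trans
            (mul_le_mul_of_nonneg_right (norm_mul_le _ _) hZ0)
        _ ≤ (2 * ε₂) * (2 * ε₂) * (2 * ε₂) :=
            mul_le_mul (mul_le_mul hZn hZn hZ0 (by positivity)) hZn hZ0 (by positivity)
    have := (abs_re_trace_le τ hτn (Z * Z * Z)).trans hZ3
    have e : 6⁻¹ * ((2 * ε₂) * (2 * ε₂) * (2 * ε₂)) = 4 / 3 * ε₂ ^ 3 := by ring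
    rw [← e]
    exact mul_le_mul_of_nonneg_left this (by norm_num)
  have e2 : |2⁻¹ * (τ (Z * (C - 2 * K))).re| ≤ 12 * ε₁ * ε₂ ^ 2 + 2 * ε₂ ^ 3 := by
    rw [abs_mul, abs_of_pos (by norm_num : (0 : ℝ) < 2⁻¹)]
    have hCKn : ‖C - 2 * K‖ ≤ 12 * ε₁ * ε₂ + 2 * ε₂ ^ 2 := norm_comm2_sub_two_lie_le h₁ h₂ hδ₁ hδ₂
    have := (abs_re_trace_le τ hτn (Z * (C - 2 * K))).trans
      ((norm_mul_le _ _).trans (mul_le_mul hZn hCKn (norm_nonneg _) (by positivity)))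
    have e : 2⁻¹ * ((2 * ε₂) * (12 * ε₁ * ε₂ + 2 * ε₂ ^ 2)) = 12 * ε₁ * ε₂ ^ 2 + 2 * ε₂ ^ 3 := by ring
    rw [← e]
    exact mul_le_mul_of_nonneg_left this (by norm_num)
  have e4 : |2⁻¹ * (τ (K * K - K₀ * K₀)).re| ≤ 4 * ε₁ ^ 3 * ε₂ := by
    rw [abs_mul, abs_of_pos (by norm_num : (0 : ℝ) < 2⁻¹)]
    have := (abs_re_trace_le τ hτn (K * K - K₀ * K₀)).trans (norm_lie_sq_sub_lie_sq_le h₁ h₂ h₄ hδ₂)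
    linarith
  have hexp : Real.exp (4 * ε₁) ≤ 3 := (Real.exp_le_exp.mpr hε).trans Real.exp_one_lt_three.le
  have e5 : |(τ T₅).re| ≤ 128 / 5 * ε₁ ^ 5 := by
    refine ((abs_re_trace_le τ hτn _).trans hT₅_le).trans ?_
    have h4 : ε₁ + ε₁ + ε₁ + ε₁ = 4 * ε₁ := by ring
    rw [h4, show ((5 : ℕ)! : ℝ) = 120 by norm_num [Nat.factorial]]
    have := mul_le_mul_of_nonneg_left hexp (by positivity : (0 : ℝ) ≤ (4 * ε₁) ^ 5 / 120)
    have e : (4 * ε₁) ^ 5 / 120 * 3 = 128 / 5 * ε₁ ^ 5 := by ring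
    linarith
  have e3 : |(τ ΔT).re| ≤ 64 * ε₁ ^ 3 * ε₂ := by
    refine ((abs_re_trace_le τ hτn _).trans hΔT_le).trans ?_
    rw [sub_neg_eq_add, sub_neg_eq_add, show ((3 : ℕ)! : ℝ) = 6 by norm_num [Nat.factorial],
      add_comm Y₃ Y₁, add_comm Y₄ Y₂]
    have hA : ‖Y₁ + Y₃‖ + ‖Y₂ + Y₄‖ ≤ ε₂ + ε₂ := add_le_add hδ₁ hδ₂
    have hB : (4 * ε₁) ^ 3 / 6 * Real.exp (4 * ε₁) ≤ (4 * ε₁) ^ 3 / 6 * 3 :=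
      mul_le_mul_of_nonneg_left hexp (by positivity)
    have := mul_le_mul hA hB (by positivity) (by positivity)
    have e : (ε₂ + ε₂) * ((4 * ε₁) ^ 3 / 6 * 3) = 64 * ε₁ ^ 3 * ε₂ := by ring
    linarith
  -- assemble
  have t4 := abs_add_le (-(6⁻¹ * (τ (Z * Z * Z)).re)) (-(2⁻¹ * (τ (Z * (C - 2 * K))).re))
  have t3 := abs_add_le (-(6⁻¹ * (τ (Z * Z * Z)).re) - 2⁻¹ * (τ (Z * (C - 2 * K))).re)
    (2⁻¹ * (τ (K * K - K₀ * K₀)).re)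
  have t2 := abs_add_le (-(6⁻¹ * (τ (Z * Z * Z)).re) - 2⁻¹ * (τ (Z * (C - 2 * K))).re
    + 2⁻¹ * (τ (K * K - K₀ * K₀)).re) (-(τ T₅).re)
  have t1 := abs_add_le (-(6⁻¹ * (τ (Z * Z * Z)).re) - 2⁻¹ * (τ (Z * (C - 2 * K))).re
    + 2⁻¹ * (τ (K * K - K₀ * K₀)).re - (τ T₅).re) (-(τ ΔT).re)
  simp only [abs_neg, ← sub_eq_add_neg] at t1 t2 t3 t4
  have hp3 := pow_nonneg hε₂ 3
  have hp5 := pow_nonneg hε₁ 5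
  linarith

end Sharp


/-! ## §6. The plaquette of the fine lattice: `1 − Re tr U(∂p) = ½ξ⁴Re tr F²_{μν}(x) + O(ξ⁵σ⁵)` -/

section Plaquette

variable {𝔸 : Type*} [NormedRing 𝔸] [NormedAlgebra ℂ 𝔸]

/-- `‖iξ•b‖ = ξ‖b‖` for `ξ ≥ 0`. [folklore] -/
private theorem norm_I_xi_smul {ξ : ℝ} (hξ : 0 ≤ ξ) (b : 𝔸) : ‖(I * ξ : ℂ) • b‖ = ξ * ‖b‖ := by
  rw [norm_smul, norm_mul, Complex.norm_I, one_mul, Complex.norm_real, Real.norm_of_nonneg hξ]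

/-- **`Z₁ + [Y₄, Y₁] = iξ²F_{μν}(x)` on the plaquette**: the first BCH term `iξ²D_{μν}(x)` (`Z1_plaq`) plus the
commutator of the two bonds AT `x`, `[−iξB_ν(x), iξB_μ(x)] = −ξ²·i[B_μ(x), B_ν(x)]·i`, is `iξ²` times (3.56)'s
`F_{μν}(x) = D_{μν}(x) + i[B_μ(x), B_ν(x)]`. [cite: Balaban1988Convergent, (3.56) p.281, (3.66) p.283] -/
theorem Z1_add_lie_plaq {ξ : ℝ} (hξ : ξ ≠ 0) (bμ bν bμ' bν' : 𝔸) :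
    Z1 ((I * ξ : ℂ) • bμ) ((I * ξ : ℂ) • bν') (-((I * ξ : ℂ) • bμ')) (-((I * ξ : ℂ) • bν))
        + ⁅-((I * ξ : ℂ) • bν), (I * ξ : ℂ) • bμ⁆
      = (I * ξ ^ 2 : ℂ) • plaqF ξ bμ bν bμ' bν' := by
  have hK : ⁅-((I * ξ : ℂ) • bν), (I * ξ : ℂ) • bμ⁆ = ((I * ξ) * (I * ξ) : ℂ) • plaqComm bμ bν := by
    rw [Ring.lie_def, plaqComm, neg_mul, mul_neg, smul_mul_smul_comm, smul_mul_smul_comm, sub_neg_eq_add,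
      smul_sub]
    abel
  rw [hK, Z1_plaq hξ, plaqF, smul_add, smul_smul]
  congr 2
  ring

/-- `Re τ((iξ²F)²) = −ξ⁴Re τ(F²)`. [folklore] -/
private theorem re_trace_sq_I_smul (τ : 𝔸 →L[ℂ] ℂ) (ξ : ℝ) (F : 𝔸) :
    (τ (((I * ξ ^ 2 : ℂ) • F) ^ 2)).re = -(ξ ^ 4 * (τ (F ^ 2)).re) := by
  rw [smul_pow, map_smul, smul_eq_mul]
  have h : ((I * ξ ^ 2) ^ 2 : ℂ) = ((-(ξ ^ 4) : ℝ) : ℂ) := by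
    push_cast
    rw [mul_pow, Complex.I_sq]
    ring
  rw [h, Complex.re_ofReal_mul]
  ring

variable [NormOneClass 𝔸] [CompleteSpace 𝔸]

/-- **(3.66) for one plaquette, to the order needed** (the sharpening of `…Eq366ActionF2.plaquette366_F`, whose
third-order remainder `s³/3` is too large to be summed over the `(2Lʲ)⁴` plaquettes under `h_z`).  In a local gauge
`U(x, x + ξe_μ) = exp iξB_μ(x)` ((2.38)) with the sup size `‖B‖ ≤ p` on the four bonds of `p_{μν}(x)` and the
gradient size `‖B_μ(x + ξe_ν) − B_μ(x)‖, ‖B_ν(x + ξe_μ) − B_ν(x)‖ ≤ ξq`, for `ξ ≤ 1`, `4ξp ≤ 1` and a normalized trace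
real on the lattice curl:
`|[1 − Re τ U(∂p_{μν}(x))] − ½ξ⁴Re τ F²_{μν}(x)| ≤ ξ⁵(4q³ + 12pq² + 68p³q + 26p⁵)` — fifth order in `ξ`, so that the
`ξ⁻⁴` plaquettes under a tent function contribute `O(ξ)·(powers of p, q)`.  For print's regular fields `p = aσ`,
`q = aσ²` (`σ = LʲL⁻ⁿ`, (2.38)/(I.4.17)) the right side is `O(ξ⁵σ⁵)`. [cite: Balaban1988Convergent, (3.66) p.283] -/
theorem plaquette366_sharp (τ : 𝔸 →L[ℂ] ℂ) (htr : ∀ a b : 𝔸, τ (a * b) = τ (b * a)) (hτ1 : τ 1 = 1)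
    (hτn : ∀ a : 𝔸, ‖τ a‖ ≤ ‖a‖) {ξ : ℝ} (hξ : 0 < ξ) (hξ1 : ξ ≤ 1) (bμ bν bμ' bν' : 𝔸) {p q : ℝ}
    (hbμ : ‖bμ‖ ≤ p) (hbν : ‖bν‖ ≤ p) (hbμ' : ‖bμ'‖ ≤ p) (hbν' : ‖bν'‖ ≤ p)
    (hdμ : ‖bμ' - bμ‖ ≤ ξ * q) (hdν : ‖bν' - bν‖ ≤ ξ * q) (hs : 4 * (ξ * p) ≤ 1)
    (hreal : (τ (plaqD ξ bμ bν bμ' bν')).im = 0) :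
    |(1 - (τ (plaqHol ξ bμ bν bμ' bν')).re) - 2⁻¹ * ξ ^ 4 * (τ (plaqF ξ bμ bν bμ' bν' ^ 2)).re|
      ≤ ξ ^ 5 * (4 * q ^ 3 + 12 * p * q ^ 2 + 68 * p ^ 3 * q + 26 * p ^ 5) := by
  have hξ0 := hξ.le
  have hp : 0 ≤ p := (norm_nonneg _).trans hbμ
  have hq : 0 ≤ q := (mul_nonneg_iff_of_pos_left hξ).mp ((norm_nonneg _).trans hdμ)
  -- the four exponents
  have h₁ : ‖(I * ξ : ℂ) • bμ‖ ≤ ξ * p := by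
    rw [norm_I_xi_smul hξ0]; exact mul_le_mul_of_nonneg_left hbμ hξ0
  have h₂ : ‖(I * ξ : ℂ) • bν'‖ ≤ ξ * p := by
    rw [norm_I_xi_smul hξ0]; exact mul_le_mul_of_nonneg_left hbν' hξ0
  have h₃ : ‖-((I * ξ : ℂ) • bμ')‖ ≤ ξ * p := by
    rw [norm_neg, norm_I_xi_smul hξ0]; exact mul_le_mul_of_nonneg_left hbμ' hξ0
  have h₄ : ‖-((I * ξ : ℂ) • bν)‖ ≤ ξ * p := by
    rw [norm_neg, norm_I_xi_smul hξ0]; exact mul_le_mul_of_nonneg_left hbν hξ0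
  have hδ₁ : ‖(I * ξ : ℂ) • bμ + -((I * ξ : ℂ) • bμ')‖ ≤ ξ ^ 2 * q := by
    rw [← sub_eq_add_neg, ← smul_sub, norm_I_xi_smul hξ0, norm_sub_rev, pow_two, mul_assoc]
    exact mul_le_mul_of_nonneg_left hdμ hξ0
  have hδ₂ : ‖(I * ξ : ℂ) • bν' + -((I * ξ : ℂ) • bν)‖ ≤ ξ ^ 2 * q := by
    rw [← sub_eq_add_neg, ← smul_sub, norm_I_xi_smul hξ0, pow_two, mul_assoc]
    exact mul_le_mul_of_nonneg_left hdν hξ0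
  have hZ := re_trace_Z1_plaq τ hξ.ne' bμ bν bμ' bν' hreal
  have h := fourExp_re_trace_expansion τ htr hτ1 hτn h₁ h₂ h₃ h₄ hδ₁ hδ₂ hs hZ
  rw [Z1_add_lie_plaq hξ.ne', re_trace_sq_I_smul] at h
  have hlhs : (1 - (τ (plaqHol ξ bμ bν bμ' bν')).re) - 2⁻¹ * ξ ^ 4 * (τ (plaqF ξ bμ bν bμ' bν' ^ 2)).re
      = (1 - (τ (exp ((I * ξ : ℂ) • bμ) * exp ((I * ξ : ℂ) • bν') * exp (-((I * ξ : ℂ) • bμ'))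
          * exp (-((I * ξ : ℂ) • bν)))).re) + 2⁻¹ * -(ξ ^ 4 * (τ (plaqF ξ bμ bν bμ' bν' ^ 2)).re) := by
    rw [plaqHol]; ring
  rw [hlhs]
  refine h.trans ?_
  have hξ65 : ξ ^ 6 * q ^ 3 ≤ ξ ^ 5 * q ^ 3 :=
    mul_le_mul_of_nonneg_right (pow_le_pow_of_le_one hξ0 hξ1 (by norm_num)) (pow_nonneg hq 3)
  have e : 4 * (ξ ^ 2 * q) ^ 3 + 12 * (ξ * p) * (ξ ^ 2 * q) ^ 2 + 68 * (ξ * p) ^ 3 * (ξ ^ 2 * q)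
      + 26 * (ξ * p) ^ 5
      = 4 * (ξ ^ 6 * q ^ 3) + ξ ^ 5 * (12 * p * q ^ 2 + 68 * p ^ 3 * q + 26 * p ^ 5) := by ring
  rw [e]
  nlinarith

end Plaquette

/-! ## §7. (3.66)'s «irrelevant terms» ESTIMATED: the tent-weighted sum over the window of `z` and the relocation
`F_{μν}(x) → F_{μν}(z)` -/

section Window

variable {𝔸 : Type*} [NormedRing 𝔸] [NormedAlgebra ℂ 𝔸]

/-- The six plaquette orientations `μ < ν` of d = 4. [cite: Balaban1988Convergent, (3.66) p.283] -/
private theorem card_pairs_fin4 : (Finset.univ.filter (fun d : Fin 4 × Fin 4 => d.1 < d.2)).card = 6 := by decide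

/-- The tent weights `h_z(x) = Πᵢ(1 − |mᵢ|/(N+1))` are nonnegative on the window `{|mᵢ| ≤ N}`.
[cite: Balaban1988Convergent, (3.40) p.275, (3.65) p.283] -/
theorem tentW_nonneg (N : ℕ) {m : Fin 4 → ℤ}
    (hm : m ∈ Fintype.piFinset (fun _ : Fin 4 => Finset.Icc (-(N : ℤ)) N)) :
    0 ≤ ∏ i, (1 - |(m i : ℝ)| / ((N : ℝ) + 1)) := by
  refine Finset.prod_nonneg fun i _ => ?_
  have hmi := Fintype.mem_piFinset.mp hm i
  rw [Finset.mem_Icc] at hmi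
  have habs : |(m i : ℝ)| ≤ N := by
    rw [abs_le]; constructor <;> exact_mod_cast (by omega)
  have hN : (0 : ℝ) < (N : ℝ) + 1 := by positivity
  rw [sub_nonneg, div_le_one hN]
  linarith

/-- `Σ_x h_z(x) = (N + 1)⁴ = ξ⁻⁴` (d = 4; `…Eq366ActionF2.tent_sum_4d_normalized`).
[cite: Balaban1988Convergent, (3.65) p.283] -/
theorem sum_tentW (N : ℕ) :
    ∑ m ∈ Fintype.piFinset (fun _ : Fin 4 => Finset.Icc (-(N : ℤ)) N), ∏ i, (1 - |(m i : ℝ)| / ((N : ℝ) + 1))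
      = ((N : ℝ) + 1) ^ 4 := by
  have h := B14.Eq366ActionF2.tent_sum_4d_normalized N
  have hN : ((N : ℝ) + 1) ^ 4 ≠ 0 := by positivity
  rw [inv_mul_eq_one₀ hN] at h
  exact h.symm

omit [NormedAlgebra ℂ 𝔸] in
/-- `|Re τ(F²) − Re τ(G²)| ≤ (‖F‖ + ‖G‖)‖F − G‖` for `|τ a| ≤ ‖a‖` — the relocation of `tr F²` from `x` to `z` costs
one difference `F(x) − F(z)`. [folklore] -/
private theorem abs_re_trace_sq_sub_sq_le [NormedAlgebra ℂ 𝔸] (τ : 𝔸 →L[ℂ] ℂ) (hτn : ∀ a : 𝔸, ‖τ a‖ ≤ ‖a‖)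
    (F G : 𝔸) : |(τ (F ^ 2)).re - (τ (G ^ 2)).re| ≤ (‖F‖ + ‖G‖) * ‖F - G‖ := by
  rw [← Complex.sub_re, ← map_sub]
  refine (abs_re_trace_le τ hτn _).trans ?_
  have h : F ^ 2 - G ^ 2 = F * (F - G) + (F - G) * G := by noncomm_ring
  rw [h]
  refine (norm_add_le _ _).trans ?_
  have a1 := norm_mul_le F (F - G)
  have a2 := norm_mul_le (F - G) G
  nlinarith [norm_nonneg F, norm_nonneg G, norm_nonneg (F - G)]

/-- Size of `F_{μν}(x) = (∂_μB_ν − ∂_νB_μ)(x) + i[B_μ(x), B_ν(x)]` from the sup size `p` and the gradient size `q`: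
`‖F‖ ≤ 2q + 2p²` (`ξ > 0`). [cite: Balaban1988Convergent, (3.56) p.281] -/
theorem norm_plaqF_le {ξ : ℝ} (hξ : 0 < ξ) {bμ bν bμ' bν' : 𝔸} {p q : ℝ} (hbμ : ‖bμ‖ ≤ p) (hbν : ‖bν‖ ≤ p)
    (hdμ : ‖bμ' - bμ‖ ≤ ξ * q) (hdν : ‖bν' - bν‖ ≤ ξ * q) :
    ‖plaqF ξ bμ bν bμ' bν'‖ ≤ 2 * q + 2 * p ^ 2 := by
  have hp : 0 ≤ p := (norm_nonneg _).trans hbμ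
  have hinv : ‖((ξ⁻¹ : ℝ) : ℂ)‖ = ξ⁻¹ := by
    rw [Complex.norm_real, Real.norm_of_nonneg (inv_nonneg.mpr hξ.le)]
  have hD : ‖plaqD ξ bμ bν bμ' bν'‖ ≤ q + q := by
    rw [plaqD, B14.Eq366ActionF2.fwdDiff, B14.Eq366ActionF2.fwdDiff]
    refine (norm_sub_le _ _).trans (add_le_add ?_ ?_)
    · rw [← Complex.coe_smul, norm_smul, hinv, inv_mul_le_iff₀ hξ]; exact hdν
    · rw [← Complex.coe_smul, norm_smul, hinv, inv_mul_le_iff₀ hξ]; exact hdμ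
  have hC : ‖I • plaqComm bμ bν‖ ≤ 2 * p ^ 2 := by
    rw [norm_smul, Complex.norm_I, one_mul, plaqComm]
    refine (norm_sub_le _ _).trans ?_
    have a1 := (norm_mul_le bμ bν).trans (mul_le_mul hbμ hbν (norm_nonneg _) hp)
    have a2 := (norm_mul_le bν bμ).trans (mul_le_mul hbν hbμ (norm_nonneg _) hp)
    nlinarith
  rw [plaqF]
  exact (norm_add_le _ _).trans (by linarith)

/-- The relocation difference of two field strengths (bonds `b` at `x`, bonds `c` at `z`): with the Hölder letter
`‖[B_μ(x+ξe_ν) − B_μ(x)] − [B_μ(z+ξe_ν) − B_μ(z)]‖ ≤ ξr` (both orientations), the displacement `‖B(x) − B(z)‖ ≤ δ` and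
the sup size `p`: `‖F_{μν}(x) − F_{μν}(z)‖ ≤ 2r + 4pδ`. [cite: Balaban1988Convergent, (3.56) p.281, (3.66) p.283] -/
theorem norm_plaqF_sub_plaqF_le {ξ : ℝ} (hξ : 0 < ξ) {bμ bν bμ' bν' cμ cν cμ' cν' : 𝔸} {p r δ : ℝ}
    (hbν : ‖bν‖ ≤ p) (hcμ : ‖cμ‖ ≤ p)
    (hrμ : ‖(bμ' - bμ) - (cμ' - cμ)‖ ≤ ξ * r) (hrν : ‖(bν' - bν) - (cν' - cν)‖ ≤ ξ * r)
    (hδμ : ‖bμ - cμ‖ ≤ δ) (hδν : ‖bν - cν‖ ≤ δ) :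
    ‖plaqF ξ bμ bν bμ' bν' - plaqF ξ cμ cν cμ' cν'‖ ≤ 2 * r + 4 * (p * δ) := by
  have hp : 0 ≤ p := (norm_nonneg _).trans hbν
  have hδ : 0 ≤ δ := (norm_nonneg _).trans hδμ
  have hinv : ‖((ξ⁻¹ : ℝ) : ℂ)‖ = ξ⁻¹ := by
    rw [Complex.norm_real, Real.norm_of_nonneg (inv_nonneg.mpr hξ.le)]
  have hD : ‖plaqD ξ bμ bν bμ' bν' - plaqD ξ cμ cν cμ' cν'‖ ≤ r + r := by
    have e : plaqD ξ bμ bν bμ' bν' - plaqD ξ cμ cν cμ' cν'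
        = (ξ⁻¹ : ℝ) • ((bν' - bν) - (cν' - cν)) - (ξ⁻¹ : ℝ) • ((bμ' - bμ) - (cμ' - cμ)) := by
      simp only [plaqD, B14.Eq366ActionF2.fwdDiff, smul_sub]
      abel
    rw [e]
    refine (norm_sub_le _ _).trans (add_le_add ?_ ?_)
    · rw [← Complex.coe_smul, norm_smul, hinv, inv_mul_le_iff₀ hξ]; exact hrν
    · rw [← Complex.coe_smul, norm_smul, hinv, inv_mul_le_iff₀ hξ]; exact hrμ
  have hC : ‖I • plaqComm bμ bν - I • plaqComm cμ cν‖ ≤ 4 * (p * δ) := by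
    rw [← smul_sub, norm_smul, Complex.norm_I, one_mul]
    have e : plaqComm bμ bν - plaqComm cμ cν = ⁅bμ - cμ, bν⁆ + ⁅cμ, bν - cν⁆ := by
      simp only [plaqComm, Ring.lie_def]
      noncomm_ring
    rw [e]
    refine (norm_add_le _ _).trans ?_
    have a1 := (norm_lie_le_two_mul (bμ - cμ) bν).trans
      (by nlinarith [mul_le_mul hδμ hbν (norm_nonneg _) hδ] : 2 * ‖bμ - cμ‖ * ‖bν‖ ≤ 2 * (δ * p))
    have a2 := (norm_lie_le_two_mul cμ (bν - cν)).trans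
      (by nlinarith [mul_le_mul hcμ hδν (norm_nonneg _) hp] : 2 * ‖cμ‖ * ‖bν - cν‖ ≤ 2 * (p * δ))
    nlinarith
  have e : plaqF ξ bμ bν bμ' bν' - plaqF ξ cμ cν cμ' cν'
      = (plaqD ξ bμ bν bμ' bν' - plaqD ξ cμ cν cμ' cν') + (I • plaqComm bμ bν - I • plaqComm cμ cν) := by
    simp only [plaqF]
    abel
  rw [e]
  exact (norm_add_le _ _).trans (by linarith)

variable [NormOneClass 𝔸] [CompleteSpace 𝔸]

/-- **(3.66), «(the irrelevant terms)» ESTIMATED — the input `|I₂ z| ≤ c₂(L^{j−n})^{5−b}` of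
`…B14.Thm2Assembly.PointDataE`.**  Print, p. 283: *«Analyzing A(h_z, U_k) in the same way as above, we obtain
A(h_z, U_k) = ½Σ_{μ<ν} tr F²_{μν}(z) + (the irrelevant terms). (3.66)»*, with p. 281: *«(the irrelevant terms)
… denotes the sum of terms which can be bounded by O((LʲL⁻ⁿ)^{5−β}) …, where β is a positive number»*.  SETTING
(j-units, d = 4): the fine lattice `T_ξ`, `ξ = L⁻ʲ = 1/(N + 1)`, around `z` (= the origin) is indexed by
`m ∈ ℤ⁴`, the window of `h_z` is `{|mᵢ| ≤ N}`, `h_z(m) = Πᵢ(1 − |mᵢ|ξ)` ((3.40)/(3.65)), the bond variables of the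
local gauge (2.38) are `B m μ = B_μ(z + ξm)` with `U(x, x + ξe_μ) = exp iξB_μ(x)`,
`A(h_z, U) = Σ_m h_z(m) Σ_{μ<ν} [1 − Re τ U(∂p_{μν}(z + ξm))]` (p. 253) and `F_{μν}` is (3.56)'s field strength
(`…Eq366ActionF2.plaqF`).  HYPOTHESES = print's regularity letters at a point of scale `n` (`σ = LʲL⁻ⁿ`,
`0 < σ ≤ θ ≤ 1`, `θ = σ^{1−β}` the Hölder factor of (I.4.18), exactly as in `…B14.Eq349IrrelevantFeed`): sup size
`‖B‖ ≤ aσ` on the window and its forward neighbours ((2.38)/(I.4.16)), gradient size `‖B_μ(x + ξe_ν) − B_μ(x)‖ ≤ ξ·aσ²`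
((2.38)/(I.4.17)), displacement `‖B(x) − B(z)‖ ≤ aσ²` on the window (|x − z| ≤ 1; (I.4.17)), the Hölder letter
`‖∇_νB_μ(x) − ∇_νB_μ(z)‖ ≤ aσ²θ` ((I.4.18)), `4aσ ≤ N + 1` (so `4ξ‖B‖ ≤ 1`), and a normalized trace real on the lattice
curls.  CONCLUSION: `|A(h_z, U) − ½Σ_{μ<ν} Re τ F²_{μν}(z)| ≤ (24a² + 168a³ + 456a⁴ + 156a⁵)·σ⁴θ` — with
`θ = σ^{1−β}` this is `c₂·(LʲL⁻ⁿ)^{5−β}`, `c₂` explicit.  Mechanism: `plaquette366_sharp` on each of the `6(2N+1)⁴`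
plaquettes (total `≤ 6ξσ⁵(16a³ + 68a⁴ + 26a⁵)` since `Σ_m h_z(m) = ξ⁻⁴`), the exact decomposition
`…Eq366ActionF2.eq366_decomposition` with `ξ⁴Σ_m h_z(m) = 1`, and the relocation
`|Re τ F²(x) − Re τ F²(z)| ≤ 8a²(1 + a)(1 + 2a)σ⁴θ`.  HONEST SCOPE: the regularity letters are hypotheses (their
derivation for Bałaban's `U_k` is [15]/[I] §4, rows B12.Eq4.16–4.18); the statement is NOT printed as such (print
gives only the outcome «O((LʲL⁻ⁿ)^{5−β})»); d = 4 and the tent normalization are those of `…Eq366ActionF2`.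
[cite: Balaban1988Convergent, (3.66) p.283] -/
theorem irrelevant366_le (τ : 𝔸 →L[ℂ] ℂ) (htr : ∀ a b : 𝔸, τ (a * b) = τ (b * a)) (hτ1 : τ 1 = 1)
    (hτn : ∀ a : 𝔸, ‖τ a‖ ≤ ‖a‖) (N : ℕ) (B : (Fin 4 → ℤ) → Fin 4 → 𝔸) {a σ θ : ℝ}
    (ha : 0 ≤ a) (hσ : 0 < σ) (hσθ : σ ≤ θ) (hθ : θ ≤ 1) (hs : 4 * (a * σ) ≤ (N : ℝ) + 1)
    (hB : ∀ m ∈ Fintype.piFinset (fun _ : Fin 4 => Finset.Icc (-((N : ℤ) + 1)) ((N : ℤ) + 1)), ∀ μ,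
      ‖B m μ‖ ≤ a * σ)
    (hD : ∀ m ∈ Fintype.piFinset (fun _ : Fin 4 => Finset.Icc (-(N : ℤ)) N), ∀ μ ν,
      ‖B (m + Pi.single ν 1) μ - B m μ‖ ≤ ((N : ℝ) + 1)⁻¹ * (a * σ ^ 2))
    (hdisp : ∀ m ∈ Fintype.piFinset (fun _ : Fin 4 => Finset.Icc (-(N : ℤ)) N), ∀ μ,
      ‖B m μ - B 0 μ‖ ≤ a * σ ^ 2)
    (hH : ∀ m ∈ Fintype.piFinset (fun _ : Fin 4 => Finset.Icc (-(N : ℤ)) N), ∀ μ ν,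
      ‖(B (m + Pi.single ν 1) μ - B m μ) - (B (Pi.single ν 1) μ - B 0 μ)‖
        ≤ ((N : ℝ) + 1)⁻¹ * (a * σ ^ 2 * θ))
    (hreal : ∀ m ∈ Fintype.piFinset (fun _ : Fin 4 => Finset.Icc (-(N : ℤ)) N), ∀ μ ν,
      (τ (plaqD ((N : ℝ) + 1)⁻¹ (B m μ) (B m ν) (B (m + Pi.single ν 1) μ) (B (m + Pi.single μ 1) ν))).im = 0) :
    |∑ m ∈ Fintype.piFinset (fun _ : Fin 4 => Finset.Icc (-(N : ℤ)) N),
        (∏ i, (1 - |(m i : ℝ)| / ((N : ℝ) + 1)))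
          * ∑ d ∈ Finset.univ.filter (fun d : Fin 4 × Fin 4 => d.1 < d.2),
            (1 - (τ (plaqHol ((N : ℝ) + 1)⁻¹ (B m d.1) (B m d.2) (B (m + Pi.single d.2 1) d.1)
              (B (m + Pi.single d.1 1) d.2))).re)
      - 2⁻¹ * ∑ d ∈ Finset.univ.filter (fun d : Fin 4 × Fin 4 => d.1 < d.2),
          (τ (plaqF ((N : ℝ) + 1)⁻¹ (B 0 d.1) (B 0 d.2) (B (Pi.single d.2 1) d.1)
            (B (Pi.single d.1 1) d.2) ^ 2)).re|
      ≤ (24 * a ^ 2 + 168 * a ^ 3 + 456 * a ^ 4 + 156 * a ^ 5) * σ ^ 4 * θ := by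
  -- abbreviations
  set ξ : ℝ := ((N : ℝ) + 1)⁻¹ with hξdef
  set X := Fintype.piFinset (fun _ : Fin 4 => Finset.Icc (-(N : ℤ)) N) with hXdef
  set Dp := Finset.univ.filter (fun d : Fin 4 × Fin 4 => d.1 < d.2) with hDpdef
  set w : (Fin 4 → ℤ) → ℝ := fun m => ∏ i, (1 - |(m i : ℝ)| / ((N : ℝ) + 1)) with hwdef
  set Fm : (Fin 4 → ℤ) → Fin 4 × Fin 4 → 𝔸 := fun m d =>
    plaqF ξ (B m d.1) (B m d.2) (B (m + Pi.single d.2 1) d.1) (B (m + Pi.single d.1 1) d.2) with hFmdef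
  set act : (Fin 4 → ℤ) → Fin 4 × Fin 4 → ℝ := fun m d =>
    1 - (τ (plaqHol ξ (B m d.1) (B m d.2) (B (m + Pi.single d.2 1) d.1) (B (m + Pi.single d.1 1) d.2))).re
    with hactdef
  set mn : (Fin 4 → ℤ) → Fin 4 × Fin 4 → ℝ := fun m d => 2⁻¹ * ξ ^ 4 * (τ (Fm m d ^ 2)).re with hmndef
  set mz : Fin 4 × Fin 4 → ℝ := fun d => 2⁻¹ * (τ (Fm 0 d ^ 2)).re with hmzdef
  -- basic positivity
  have hN1 : (0 : ℝ) < (N : ℝ) + 1 := by positivity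
  have hξ : 0 < ξ := inv_pos.mpr hN1
  have hξ1 : ξ ≤ 1 := inv_le_one_of_one_le₀ (by linarith)
  have hσ0 := hσ.le
  have hσ1 : σ ≤ 1 := hσθ.trans hθ
  have hθ0 : 0 ≤ θ := hσ0.trans hσθ
  have h0X : (0 : Fin 4 → ℤ) ∈ X := by
    refine Fintype.mem_piFinset.mpr fun i => ?_
    simp
  -- membership of the plaquette corners in the big box
  have hbig : ∀ m ∈ X, ∀ ν : Fin 4, m ∈ Fintype.piFinset (fun _ : Fin 4 => Finset.Icc (-((N : ℤ) + 1))
      ((N : ℤ) + 1)) ∧ m + Pi.single ν 1 ∈ Fintype.piFinset (fun _ : Fin 4 => Finset.Icc (-((N : ℤ) + 1))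
      ((N : ℤ) + 1)) := by
    intro m hm ν
    have hmi := fun i => Finset.mem_Icc.mp (Fintype.mem_piFinset.mp hm i)
    refine ⟨Fintype.mem_piFinset.mpr fun i => Finset.mem_Icc.mpr ⟨?_, ?_⟩,
      Fintype.mem_piFinset.mpr fun i => Finset.mem_Icc.mpr ⟨?_, ?_⟩⟩
    · have := (hmi i).1; omega
    · have := (hmi i).2; omega
    · rw [Pi.add_apply, Pi.single_apply]
      have := (hmi i).1; split_ifs <;> omega
    · rw [Pi.add_apply, Pi.single_apply]
      have := (hmi i).2; split_ifs <;> omega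
  -- the smallness `4ξ(aσ) ≤ 1`
  have hsm : 4 * (ξ * (a * σ)) ≤ 1 := by
    rw [hξdef, inv_mul_eq_div, mul_div_assoc', div_le_one hN1]
    exact hs
  have hN4ξ : ((N : ℝ) + 1) ^ 4 * ξ ^ 4 = 1 := by
    rw [hξdef, inv_pow, mul_inv_cancel₀ (by positivity)]
  have hN4ξ5 : ((N : ℝ) + 1) ^ 4 * ξ ^ 5 = ξ := by
    rw [show ξ ^ 5 = ξ ^ 4 * ξ by ring, ← mul_assoc, hN4ξ, one_mul]
  -- the sizes at a point of scale n
  set p : ℝ := a * σ with hpdef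
  set q : ℝ := a * σ ^ 2 with hqdef
  have hp0 : 0 ≤ p := by positivity
  have hq0 : 0 ≤ q := by positivity
  set cp : ℝ := 16 * a ^ 3 + 68 * a ^ 4 + 26 * a ^ 5 with hcpdef
  have hcp0 : 0 ≤ cp := by positivity
  set ρ0 : ℝ := (4 * q + 4 * p ^ 2) * (a * σ ^ 2 * θ + 2 * (p * q)) with hρ0def
  have hρ00 : 0 ≤ ρ0 := by positivity
  -- bond sizes at the corners of the plaquettes of the window
  have hBm : ∀ m ∈ X, ∀ μ, ‖B m μ‖ ≤ p := fun m hm μ => hB m (hbig m hm 0).1 μ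
  have hBm' : ∀ m ∈ X, ∀ μ ν, ‖B (m + Pi.single ν 1) μ‖ ≤ p := fun m hm μ ν => hB _ (hbig m hm ν).2 μ
  -- (r) the plaquette remainders
  have hr : ∀ m ∈ X, ∀ d ∈ Dp, |act m d - mn m d| ≤ ξ ^ 5 * (σ ^ 5 * cp) := by
    intro m hm d _
    have h := plaquette366_sharp τ htr hτ1 hτn hξ hξ1 (B m d.1) (B m d.2) (B (m + Pi.single d.2 1) d.1)
      (B (m + Pi.single d.1 1) d.2) (hBm m hm d.1) (hBm m hm d.2) (hBm' m hm d.1 d.2) (hBm' m hm d.2 d.1)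
      (hD m hm d.1 d.2) (hD m hm d.2 d.1) hsm (hreal m hm d.1 d.2)
    refine h.trans (mul_le_mul_of_nonneg_left ?_ (pow_nonneg hξ.le 5))
    have hσ65 : σ ^ 6 ≤ σ ^ 5 := pow_le_pow_of_le_one hσ0 hσ1 (by norm_num)
    have e : 4 * q ^ 3 + 12 * p * q ^ 2 + 68 * p ^ 3 * q + 26 * p ^ 5
        = 4 * a ^ 3 * σ ^ 6 + σ ^ 5 * (12 * a ^ 3 + 68 * a ^ 4 + 26 * a ^ 5) := by
      rw [hpdef, hqdef]; ring
    rw [e, hcpdef]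
    nlinarith [pow_nonneg ha 3, pow_nonneg hσ0 5]
  -- (ρ) the relocation differences
  have hF0 : ∀ d, Fm 0 d = plaqF ξ (B 0 d.1) (B 0 d.2) (B (Pi.single d.2 1) d.1) (B (Pi.single d.1 1) d.2) := by
    intro d; simp only [hFmdef, zero_add]
  have hρ : ∀ m ∈ X, ∀ d ∈ Dp, |mn m d - ξ ^ 4 * mz d| ≤ ξ ^ 4 * ρ0 := by
    intro m hm d _
    have hFm_n : ‖Fm m d‖ ≤ 2 * q + 2 * p ^ 2 :=
      norm_plaqF_le hξ (hBm m hm d.1) (hBm m hm d.2) (hD m hm d.1 d.2) (hD m hm d.2 d.1)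
    have hF0_n : ‖Fm 0 d‖ ≤ 2 * q + 2 * p ^ 2 := by
      rw [hF0]
      have h1 := hD 0 h0X d.1 d.2
      have h2 := hD 0 h0X d.2 d.1
      rw [zero_add] at h1 h2
      exact norm_plaqF_le hξ (hBm 0 h0X d.1) (hBm 0 h0X d.2) h1 h2
    have hdiff : ‖Fm m d - Fm 0 d‖ ≤ 2 * (a * σ ^ 2 * θ) + 4 * (p * q) := by
      rw [hF0]
      exact norm_plaqF_sub_plaqF_le hξ (hBm m hm d.2) (hBm 0 h0X d.1) (hH m hm d.1 d.2) (hH m hm d.2 d.1)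
        (hdisp m hm d.1) (hdisp m hm d.2)
    have hsq := abs_re_trace_sq_sub_sq_le τ hτn (Fm m d) (Fm 0 d)
    have hξ4 : 0 ≤ 2⁻¹ * ξ ^ 4 := by positivity
    have e : mn m d - ξ ^ 4 * mz d = 2⁻¹ * ξ ^ 4 * ((τ (Fm m d ^ 2)).re - (τ (Fm 0 d ^ 2)).re) := by
      rw [hmndef, hmzdef]; ring
    rw [e, abs_mul, abs_of_nonneg hξ4]
    have hprod : (‖Fm m d‖ + ‖Fm 0 d‖) * ‖Fm m d - Fm 0 d‖
        ≤ (2 * q + 2 * p ^ 2 + (2 * q + 2 * p ^ 2)) * (2 * (a * σ ^ 2 * θ) + 4 * (p * q)) :=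
      mul_le_mul (add_le_add hFm_n hF0_n) hdiff (norm_nonneg _) (by positivity)
    have e2 : 2⁻¹ * ξ ^ 4 * ((2 * q + 2 * p ^ 2 + (2 * q + 2 * p ^ 2)) * (2 * (a * σ ^ 2 * θ) + 4 * (p * q)))
        = ξ ^ 4 * ρ0 := by rw [hρ0def]; ring
    rw [← e2]
    exact mul_le_mul_of_nonneg_left (hsq.trans hprod) hξ4
  -- the tent weights
  have hh : ∀ x ∈ X, 0 ≤ w x := fun x hx => tentW_nonneg N hx
  have hsumw : ∑ x ∈ X, w x = ((N : ℝ) + 1) ^ 4 := sum_tentW N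
  have hnorm : ∑ x ∈ X, w x * ξ ^ 4 = 1 := by rw [← Finset.sum_mul, hsumw, hN4ξ]
  -- (3.66)'s exact decomposition with the plaquette remainders bounded
  have key := B14.Eq366ActionF2.eq366 X Dp w act mn (fun _ _ => ξ ^ 5 * (σ ^ 5 * cp)) mz hnorm hh hr
  have hR1 : ∑ x ∈ X, w x * ∑ _d ∈ Dp, ξ ^ 5 * (σ ^ 5 * cp) = 6 * (ξ * σ ^ 5) * cp := by
    rw [Finset.sum_const, hDpdef, card_pairs_fin4, nsmul_eq_mul, ← Finset.sum_mul, hsumw]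
    have : ((N : ℝ) + 1) ^ 4 * (((6 : ℕ) : ℝ) * (ξ ^ 5 * (σ ^ 5 * cp))) = 6 * (((N : ℝ) + 1) ^ 4 * ξ ^ 5)
        * σ ^ 5 * cp := by push_cast; ring
    rw [this, hN4ξ5]
    ring
  have hR2 : |∑ x ∈ X, w x * ∑ d ∈ Dp, (mn x d - ξ ^ 4 * mz d)| ≤ 6 * ρ0 := by
    have hterm : ∀ x ∈ X, |w x * ∑ d ∈ Dp, (mn x d - ξ ^ 4 * mz d)| ≤ w x * ∑ _d ∈ Dp, ξ ^ 4 * ρ0 := by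
      intro x hx
      rw [abs_mul, abs_of_nonneg (hh x hx)]
      exact mul_le_mul_of_nonneg_left ((Finset.abs_sum_le_sum_abs _ _).trans
        (Finset.sum_le_sum fun d hd => hρ x hx d hd)) (hh x hx)
    refine (Finset.abs_sum_le_sum_abs _ _).trans ((Finset.sum_le_sum hterm).trans (le_of_eq ?_))
    rw [Finset.sum_const, hDpdef, card_pairs_fin4, nsmul_eq_mul, ← Finset.sum_mul, hsumw]
    have : ((N : ℝ) + 1) ^ 4 * (((6 : ℕ) : ℝ) * (ξ ^ 4 * ρ0)) = 6 * (((N : ℝ) + 1) ^ 4 * ξ ^ 4) * ρ0 := by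
      push_cast; ring
    rw [this, hN4ξ, mul_one]
  -- the goal in abstract form
  have hmz : 2⁻¹ * ∑ d ∈ Dp, (τ (plaqF ξ (B 0 d.1) (B 0 d.2) (B (Pi.single d.2 1) d.1)
      (B (Pi.single d.1 1) d.2) ^ 2)).re = ∑ d ∈ Dp, mz d := by
    rw [Finset.mul_sum]
    refine Finset.sum_congr rfl fun d _ => ?_
    simp only [hmzdef, hF0]
  show |∑ m ∈ X, w m * ∑ d ∈ Dp, act m d - 2⁻¹ * ∑ d ∈ Dp, (τ (plaqF ξ (B 0 d.1) (B 0 d.2)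
      (B (Pi.single d.2 1) d.1) (B (Pi.single d.1 1) d.2) ^ 2)).re|
    ≤ (24 * a ^ 2 + 168 * a ^ 3 + 456 * a ^ 4 + 156 * a ^ 5) * σ ^ 4 * θ
  rw [hmz]
  have hsplit : ∑ m ∈ X, w m * ∑ d ∈ Dp, act m d - ∑ d ∈ Dp, mz d
      = (∑ m ∈ X, w m * ∑ d ∈ Dp, act m d - ∑ d ∈ Dp, mz d - ∑ x ∈ X, w x * ∑ d ∈ Dp, (mn x d - ξ ^ 4 * mz d))
        + ∑ x ∈ X, w x * ∑ d ∈ Dp, (mn x d - ξ ^ 4 * mz d) := by ring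
  rw [hsplit]
  refine (abs_add_le _ _).trans ?_
  rw [hR1] at key
  refine (add_le_add key hR2).trans ?_
  -- arithmetic: 6ξσ⁵·cp + 6ρ0 ≤ c₂σ⁴θ
  have hT0 : 0 ≤ σ ^ 4 * θ := by positivity
  have s5 : σ ^ 5 ≤ σ ^ 4 * θ := by
    rw [pow_succ]; exact mul_le_mul_of_nonneg_left hσθ (pow_nonneg hσ0 4)
  have xs : ξ * σ ^ 5 ≤ σ ^ 4 * θ := (mul_le_of_le_one_left (pow_nonneg hσ0 5) hξ1).trans s5
  have b1 : 6 * (ξ * σ ^ 5) * cp ≤ 6 * (σ ^ 4 * θ) * cp :=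
    mul_le_mul_of_nonneg_right (mul_le_mul_of_nonneg_left xs (by norm_num)) hcp0
  have ha3 : 0 ≤ 48 * a ^ 3 * (1 + a) := by positivity
  have b2 : 48 * a ^ 3 * (1 + a) * σ ^ 5 ≤ 48 * a ^ 3 * (1 + a) * (σ ^ 4 * θ) :=
    mul_le_mul_of_nonneg_left s5 ha3
  have eρ : 6 * ρ0 = 24 * a ^ 2 * (1 + a) * (σ ^ 4 * θ) + 48 * a ^ 3 * (1 + a) * σ ^ 5 := by
    rw [hρ0def, hpdef, hqdef]; ring
  have ec : (24 * a ^ 2 + 168 * a ^ 3 + 456 * a ^ 4 + 156 * a ^ 5) * σ ^ 4 * θ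
      = 6 * (σ ^ 4 * θ) * cp + 24 * a ^ 2 * (1 + a) * (σ ^ 4 * θ) + 48 * a ^ 3 * (1 + a) * (σ ^ 4 * θ) := by
    rw [hcpdef]; ring
  rw [eρ, ec]
  linarith

end Window

/-! ## §8. Print's exponent: `σ⁴θ = (LʲL⁻ⁿ)^{5−β}` for `σ = L^{j−n}`, `θ = σ^{1−β}` (v1.1, same seat) -/

section PrintedShape

variable {𝔸 : Type*} [NormedRing 𝔸] [NormedAlgebra ℂ 𝔸] [NormOneClass 𝔸] [CompleteSpace 𝔸]

/-- The scale `σ = L^{j−n}` of a point of scale `n ≥ j` lies in `(0, 1]` for `L ≥ 1`. [folklore] -/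
private theorem sigma_pos_le_one {L : ℝ} (hL : 1 ≤ L) {j n : ℕ} (hjn : j ≤ n) :
    0 < L ^ ((j : ℝ) - n) ∧ L ^ ((j : ℝ) - n) ≤ 1 := by
  refine ⟨Real.rpow_pos_of_pos (lt_of_lt_of_le one_pos hL) _, Real.rpow_le_one_of_one_le_of_nonpos hL ?_⟩
  have : (j : ℝ) ≤ n := by exact_mod_cast hjn
  linarith

/-- For `0 < σ ≤ 1`, `0 ≤ β ≤ 1`: `σ ≤ σ^{1−β} ≤ 1` (the Hölder factor lies between `σ` and `1`). [folklore] -/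
private theorem holder_theta_bounds {σ β : ℝ} (hσ0 : 0 < σ) (hσ1 : σ ≤ 1) (hβ0 : 0 ≤ β) (hβ1 : β ≤ 1) :
    σ ≤ σ ^ (1 - β) ∧ σ ^ (1 - β) ≤ 1 := by
  refine ⟨?_, Real.rpow_le_one hσ0.le hσ1 (by linarith)⟩
  calc σ = σ ^ (1 : ℝ) := (Real.rpow_one σ).symm
    _ ≤ σ ^ (1 - β) := Real.rpow_le_rpow_of_exponent_ge hσ0 hσ1 (by linarith)

/-- `σ⁴·σ^{1−β} = σ^{5−β}` for `σ > 0`. [folklore] -/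
private theorem sigma4_mul_theta {σ β : ℝ} (hσ : 0 < σ) : σ ^ 4 * σ ^ (1 - β) = σ ^ ((5 : ℝ) - β) := by
  have e4 : σ ^ 4 = σ ^ (4 : ℝ) := by exact_mod_cast (Real.rpow_natCast σ 4).symm
  rw [e4, ← Real.rpow_add hσ]
  congr 1
  ring

/-- **(3.66)'s irrelevant terms in PRINT'S SHAPE «O((LʲL⁻ⁿ)^{5−β})»** — `irrelevant366_le` at `σ = L^{j−n}`,
`θ = σ^{1−β}` (`L ≥ 1`, `j ≤ n`, `0 ≤ β ≤ 1`; `β` = print's «positive number» of p. 281 = the exponent letter `b` of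
`…B14.Thm2Assembly.PointDataE`): under the same regularity letters,
`|A(h_z, U) − ½Σ_{μ<ν} Re τ F²_{μν}(z)| ≤ (24a² + 168a³ + 456a⁴ + 156a⁵)·(L^{j−n})^{5−β}` — literally the input
`|I₂ z| ≤ c₂(L^{j − sc z})^{5−b}` of `PointDataE` with `A z = Q z + I₂ z`, `Q z = ½Σ_{μ<ν} Re τ F²_{μν}(z)`.
[cite: Balaban1988Convergent, (3.66)-(3.67) p.283] -/
theorem irrelevant366_printedShape (τ : 𝔸 →L[ℂ] ℂ) (htr : ∀ a b : 𝔸, τ (a * b) = τ (b * a)) (hτ1 : τ 1 = 1)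
    (hτn : ∀ a : 𝔸, ‖τ a‖ ≤ ‖a‖) (N : ℕ) (B : (Fin 4 → ℤ) → Fin 4 → 𝔸) {a L β : ℝ} {j n : ℕ}
    (ha : 0 ≤ a) (hL : 1 ≤ L) (hjn : j ≤ n) (hβ0 : 0 ≤ β) (hβ1 : β ≤ 1)
    (hs : 4 * (a * L ^ ((j : ℝ) - n)) ≤ (N : ℝ) + 1)
    (hB : ∀ m ∈ Fintype.piFinset (fun _ : Fin 4 => Finset.Icc (-((N : ℤ) + 1)) ((N : ℤ) + 1)), ∀ μ,
      ‖B m μ‖ ≤ a * L ^ ((j : ℝ) - n))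
    (hD : ∀ m ∈ Fintype.piFinset (fun _ : Fin 4 => Finset.Icc (-(N : ℤ)) N), ∀ μ ν,
      ‖B (m + Pi.single ν 1) μ - B m μ‖ ≤ ((N : ℝ) + 1)⁻¹ * (a * (L ^ ((j : ℝ) - n)) ^ 2))
    (hdisp : ∀ m ∈ Fintype.piFinset (fun _ : Fin 4 => Finset.Icc (-(N : ℤ)) N), ∀ μ,
      ‖B m μ - B 0 μ‖ ≤ a * (L ^ ((j : ℝ) - n)) ^ 2)
    (hH : ∀ m ∈ Fintype.piFinset (fun _ : Fin 4 => Finset.Icc (-(N : ℤ)) N), ∀ μ ν,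
      ‖(B (m + Pi.single ν 1) μ - B m μ) - (B (Pi.single ν 1) μ - B 0 μ)‖
        ≤ ((N : ℝ) + 1)⁻¹ * (a * (L ^ ((j : ℝ) - n)) ^ 2 * (L ^ ((j : ℝ) - n)) ^ (1 - β)))
    (hreal : ∀ m ∈ Fintype.piFinset (fun _ : Fin 4 => Finset.Icc (-(N : ℤ)) N), ∀ μ ν,
      (τ (plaqD ((N : ℝ) + 1)⁻¹ (B m μ) (B m ν) (B (m + Pi.single ν 1) μ) (B (m + Pi.single μ 1) ν))).im = 0) :
    |∑ m ∈ Fintype.piFinset (fun _ : Fin 4 => Finset.Icc (-(N : ℤ)) N),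
        (∏ i, (1 - |(m i : ℝ)| / ((N : ℝ) + 1)))
          * ∑ d ∈ Finset.univ.filter (fun d : Fin 4 × Fin 4 => d.1 < d.2),
            (1 - (τ (plaqHol ((N : ℝ) + 1)⁻¹ (B m d.1) (B m d.2) (B (m + Pi.single d.2 1) d.1)
              (B (m + Pi.single d.1 1) d.2))).re)
      - 2⁻¹ * ∑ d ∈ Finset.univ.filter (fun d : Fin 4 × Fin 4 => d.1 < d.2),
          (τ (plaqF ((N : ℝ) + 1)⁻¹ (B 0 d.1) (B 0 d.2) (B (Pi.single d.2 1) d.1)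
            (B (Pi.single d.1 1) d.2) ^ 2)).re|
      ≤ (24 * a ^ 2 + 168 * a ^ 3 + 456 * a ^ 4 + 156 * a ^ 5) * (L ^ ((j : ℝ) - n)) ^ ((5 : ℝ) - β) := by
  obtain ⟨hσ0, hσ1⟩ := sigma_pos_le_one hL hjn
  obtain ⟨hσθ, hθ1⟩ := holder_theta_bounds hσ0 hσ1 hβ0 hβ1
  have h := irrelevant366_le τ htr hτ1 hτn N B ha hσ0 hσθ hθ1 hs hB hD hdisp hH hreal
  rw [← sigma4_mul_theta hσ0, ← mul_assoc]
  exact h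

end PrintedShape

/-! ## §9. Consumer form (v1.2, same seat): the displacement letter DERIVED from the gradient letter along lattice
paths inside the window, and the reality of `τ` on the lattice curl DERIVED from self-adjointness -/

section Consumer

variable {𝔸 : Type*} [NormedRing 𝔸] [NormedAlgebra ℂ 𝔸]

omit [NormedAlgebra ℂ 𝔸] in
/-- A walk along one lattice axis inside the window: if `pth(s + 1) = pth(s) + e_ν`, `pth(s)` lies in the window for
`|s| ≤ N`, and nearest-neighbour differences of `f` are `≤ δ` on the window, then `‖f(pth t) − f(pth 0)‖ ≤ |t|·δ` for
`|t| ≤ N` (telescoping along the axis). [folklore] -/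
private theorem norm_sub_le_axis_walk (N : ℕ) (f : (Fin 4 → ℤ) → 𝔸) {δ : ℝ}
    (hstep : ∀ x ∈ Fintype.piFinset (fun _ : Fin 4 => Finset.Icc (-(N : ℤ)) N), ∀ ν : Fin 4,
      ‖f (x + Pi.single ν 1) - f x‖ ≤ δ)
    (ν : Fin 4) (pth : ℤ → (Fin 4 → ℤ)) (hpth : ∀ s, pth (s + 1) = pth s + Pi.single ν 1)
    (hmem : ∀ s : ℤ, |s| ≤ N → pth s ∈ Fintype.piFinset (fun _ : Fin 4 => Finset.Icc (-(N : ℤ)) N)) :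
    ∀ t : ℤ, |t| ≤ N → ‖f (pth t) - f (pth 0)‖ ≤ |t| * δ := by
  have hδ : 0 ≤ δ := by
    have h0 : (0 : ℤ) ≤ N := by positivity
    have := hstep (pth 0) (hmem 0 (by simp)) ν
    exact (norm_nonneg _).trans this
  -- nonnegative direction
  have hpos : ∀ n : ℕ, (n : ℤ) ≤ N → ‖f (pth n) - f (pth 0)‖ ≤ (n : ℝ) * δ := by
    intro n
    induction n with
    | zero => intro _; simp
    | succ n ih =>
      intro hn
      have hn' : (n : ℤ) ≤ N := by push_cast at hn; omega
      have hmemn : pth n ∈ Fintype.piFinset (fun _ : Fin 4 => Finset.Icc (-(N : ℤ)) N) :=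
        hmem n (by rw [abs_of_nonneg (by positivity)]; exact hn')
      have hst := hstep (pth n) hmemn ν
      rw [← hpth] at hst
      have e : ((n + 1 : ℕ) : ℤ) = (n : ℤ) + 1 := by push_cast; ring
      rw [e]
      calc ‖f (pth ((n : ℤ) + 1)) - f (pth 0)‖
          ≤ ‖f (pth ((n : ℤ) + 1)) - f (pth n)‖ + ‖f (pth n) - f (pth 0)‖ := norm_sub_le_norm_sub_add_norm_sub _ _ _
        _ ≤ δ + (n : ℝ) * δ := add_le_add hst (ih hn')
        _ = ((n + 1 : ℕ) : ℝ) * δ := by push_cast; ring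
  -- negative direction
  have hneg : ∀ n : ℕ, (n : ℤ) ≤ N → ‖f (pth (-(n : ℤ))) - f (pth 0)‖ ≤ (n : ℝ) * δ := by
    intro n
    induction n with
    | zero => intro _; simp
    | succ n ih =>
      intro hn
      have hn' : (n : ℤ) ≤ N := by push_cast at hn; omega
      have hmemn : pth (-((n : ℤ) + 1)) ∈ Fintype.piFinset (fun _ : Fin 4 => Finset.Icc (-(N : ℤ)) N) :=
        hmem _ (by rw [abs_neg, abs_of_nonneg (by positivity)]; push_cast at hn; exact hn)
      have hst := hstep (pth (-((n : ℤ) + 1))) hmemn ν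
      rw [← hpth, show -((n : ℤ) + 1) + 1 = -(n : ℤ) by ring] at hst
      have e : -((n + 1 : ℕ) : ℤ) = -((n : ℤ) + 1) := by push_cast; ring
      rw [e]
      calc ‖f (pth (-((n : ℤ) + 1))) - f (pth 0)‖
          ≤ ‖f (pth (-((n : ℤ) + 1))) - f (pth (-(n : ℤ)))‖ + ‖f (pth (-(n : ℤ))) - f (pth 0)‖ :=
            norm_sub_le_norm_sub_add_norm_sub _ _ _
        _ ≤ δ + (n : ℝ) * δ := by rw [norm_sub_rev]; exact add_le_add hst (ih hn')
        _ = ((n + 1 : ℕ) : ℝ) * δ := by push_cast; ring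
  intro t ht
  rcases Int.eq_nat_or_neg t with ⟨n, rfl | rfl⟩
  · rw [Nat.abs_cast] at ht ⊢
    exact_mod_cast hpos n ht
  · rw [abs_neg, Nat.abs_cast] at ht ⊢
    exact_mod_cast hneg n ht

omit [NormedAlgebra ℂ 𝔸] in
/-- **The displacement letter from the gradient letter**: on the window `{|mᵢ| ≤ N}`, nearest-neighbour differences
`≤ δ` give `‖f(m) − f(0)‖ ≤ 4N·δ` (a lattice path from `0` to `m` along the four axes stays in the window; its length
is `Σᵢ|mᵢ| ≤ 4N`).  With `δ = ξ·aσ²`, `ξ = 1/(N + 1)`: `‖B(x) − B(z)‖ ≤ 4aσ²` ((I.4.17) integrated over the support of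
`h_z`). [cite: Balaban1987RG1, (4.17) p.285] -/
theorem norm_sub_origin_le_of_steps (N : ℕ) (f : (Fin 4 → ℤ) → 𝔸) {δ : ℝ}
    (hstep : ∀ x ∈ Fintype.piFinset (fun _ : Fin 4 => Finset.Icc (-(N : ℤ)) N), ∀ ν : Fin 4,
      ‖f (x + Pi.single ν 1) - f x‖ ≤ δ)
    {m : Fin 4 → ℤ} (hm : m ∈ Fintype.piFinset (fun _ : Fin 4 => Finset.Icc (-(N : ℤ)) N)) :
    ‖f m - f 0‖ ≤ 4 * (N : ℝ) * δ := by
  have hmi : ∀ i, |m i| ≤ N := fun i => by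
    have := Finset.mem_Icc.mp (Fintype.mem_piFinset.mp hm i)
    exact abs_le.mpr ⟨this.1, this.2⟩
  have hδ : 0 ≤ δ := by
    have h0 : (0 : Fin 4 → ℤ) ∈ Fintype.piFinset (fun _ : Fin 4 => Finset.Icc (-(N : ℤ)) N) :=
      Fintype.mem_piFinset.mpr fun i => by simp
    exact (norm_nonneg _).trans (hstep 0 h0 0)
  -- the four axis walks
  let pth₀ : ℤ → (Fin 4 → ℤ) := fun s => ![s, 0, 0, 0]
  let pth₁ : ℤ → (Fin 4 → ℤ) := fun s => ![m 0, s, 0, 0]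
  let pth₂ : ℤ → (Fin 4 → ℤ) := fun s => ![m 0, m 1, s, 0]
  let pth₃ : ℤ → (Fin 4 → ℤ) := fun s => ![m 0, m 1, m 2, s]
  have mem_of : ∀ v : Fin 4 → ℤ, (∀ i, |v i| ≤ N) →
      v ∈ Fintype.piFinset (fun _ : Fin 4 => Finset.Icc (-(N : ℤ)) N) := fun v hv =>
    Fintype.mem_piFinset.mpr fun i => Finset.mem_Icc.mpr (abs_le.mp (hv i))
  have w₀ := norm_sub_le_axis_walk N f hstep 0 pth₀
    (fun s => by ext i; fin_cases i <;> simp [pth₀])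
    (fun s hs => mem_of _ fun i => by fin_cases i <;> simp [pth₀, hs]) (m 0) (hmi 0)
  have w₁ := norm_sub_le_axis_walk N f hstep 1 pth₁
    (fun s => by ext i; fin_cases i <;> simp [pth₁])
    (fun s hs => mem_of _ fun i => by fin_cases i <;> simp [pth₁, hs, hmi]) (m 1) (hmi 1)
  have w₂ := norm_sub_le_axis_walk N f hstep 2 pth₂
    (fun s => by ext i; fin_cases i <;> simp [pth₂])
    (fun s hs => mem_of _ fun i => by fin_cases i <;> simp [pth₂, hs, hmi]) (m 2) (hmi 2)
  have w₃ := norm_sub_le_axis_walk N f hstep 3 pth₃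
    (fun s => by ext i; fin_cases i <;> simp [pth₃])
    (fun s hs => mem_of _ fun i => by fin_cases i <;> simp [pth₃, hs, hmi]) (m 3) (hmi 3)
  -- joints of the walks
  have j₀ : pth₀ 0 = 0 := by ext i; fin_cases i <;> simp [pth₀]
  have j₁ : pth₁ 0 = pth₀ (m 0) := by ext i; fin_cases i <;> simp [pth₀, pth₁]
  have j₂ : pth₂ 0 = pth₁ (m 1) := by ext i; fin_cases i <;> simp [pth₁, pth₂]
  have j₃ : pth₃ 0 = pth₂ (m 2) := by ext i; fin_cases i <;> simp [pth₂, pth₃]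
  have j₄ : pth₃ (m 3) = m := by ext i; fin_cases i <;> simp [pth₃]
  rw [← j₄, ← j₀]
  have hN : ∀ i, (|m i| : ℝ) * δ ≤ (N : ℝ) * δ := fun i =>
    mul_le_mul_of_nonneg_right (by exact_mod_cast hmi i) hδ
  calc ‖f (pth₃ (m 3)) - f (pth₀ 0)‖
      ≤ ‖f (pth₃ (m 3)) - f (pth₃ 0)‖ + ‖f (pth₂ (m 2)) - f (pth₂ 0)‖ + ‖f (pth₁ (m 1)) - f (pth₁ 0)‖
          + ‖f (pth₀ (m 0)) - f (pth₀ 0)‖ := by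
        rw [j₃, j₂, j₁]
        have t1 := norm_sub_le_norm_sub_add_norm_sub (f (pth₃ (m 3))) (f (pth₂ (m 2))) (f (pth₀ 0))
        have t2 := norm_sub_le_norm_sub_add_norm_sub (f (pth₂ (m 2))) (f (pth₁ (m 1))) (f (pth₀ 0))
        have t3 := norm_sub_le_norm_sub_add_norm_sub (f (pth₁ (m 1))) (f (pth₀ (m 0))) (f (pth₀ 0))
        linarith
    _ ≤ (|m 3| : ℝ) * δ + (|m 2| : ℝ) * δ + (|m 1| : ℝ) * δ + (|m 0| : ℝ) * δ := by
        have := w₃; have := w₂; have := w₁; have := w₀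
        push_cast at w₀ w₁ w₂ w₃ ⊢
        linarith
    _ ≤ 4 * (N : ℝ) * δ := by have := hN 0; have := hN 1; have := hN 2; have := hN 3; linarith

/-- **Reality of the trace of the lattice curl from self-adjointness**: for a star-compatible `τ` (`τ(a*) = conj τ(a)`)
and self-adjoint bond variables, `Im τ(D_{μν}(x)) = 0` (`D = ξ⁻¹(B_ν(x+ξe_μ) − B_ν(x)) − ξ⁻¹(B_μ(x+ξe_ν) − B_μ(x))` is
self-adjoint) — the hypothesis `hreal` of `plaquette366_sharp` / `irrelevant366_le` for Hermitian fields and print's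
`tr`. [folklore] -/
private theorem im_trace_plaqD_eq_zero [StarRing 𝔸] [StarModule ℂ 𝔸] (τ : 𝔸 →L[ℂ] ℂ)
    (hstar : ∀ a : 𝔸, τ (star a) = starRingEnd ℂ (τ a)) (ξ : ℝ) {bμ bν bμ' bν' : 𝔸}
    (hμ : IsSelfAdjoint bμ) (hν : IsSelfAdjoint bν) (hμ' : IsSelfAdjoint bμ') (hν' : IsSelfAdjoint bν') :
    (τ (plaqD ξ bμ bν bμ' bν')).im = 0 := by
  have hD : IsSelfAdjoint (plaqD ξ bμ bν bμ' bν') := by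
    rw [plaqD, B14.Eq366ActionF2.fwdDiff, B14.Eq366ActionF2.fwdDiff]
    exact ((IsSelfAdjoint.all _).smul (hν'.sub hν)).sub ((IsSelfAdjoint.all _).smul (hμ'.sub hμ))
  have h := hstar (plaqD ξ bμ bν bμ' bν')
  rw [hD.star_eq] at h
  exact Complex.conj_eq_iff_im.mp h.symm

variable [NormOneClass 𝔸] [CompleteSpace 𝔸]

/-- **(3.66)'s irrelevant terms, consumer form** — the letters reduced to print's: HERMITIAN bond variables (𝔤-valued
`B`, (2.38) `U^u = exp iξA`), a star-compatible normalized trace (print's `tr`), and the THREE regularity letters at scale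
`n`: sup `‖B‖ ≤ aσ` and gradient `‖B_μ(x + ξe_ν) − B_μ(x)‖ ≤ ξ·aσ²` ((2.38): `Lⁿξ|A|, (Lⁿξ)²|∇^ξA| < BCMα_{0,n}`;
(I.4.17)), and the Hölder letter `‖∇_νB_μ(x) − ∇_νB_μ(z)‖ ≤ aσ²θ` ((I.4.18), `θ = σ^{1−β}`); the displacement letter of
`irrelevant366_le` is DERIVED (`norm_sub_origin_le_of_steps`, constant `4aσ²`, whence the letter `4a` below and the
smallness `16aσ ≤ N + 1`) and the reality of `τ` on the curls is DERIVED (`im_trace_plaqD_eq_zero`).  Conclusion: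
`|A(h_z, U) − ½Σ_{μ<ν} Re τ F²_{μν}(z)| ≤ c₂(4a)·σ⁴θ`, `c₂(x) = 24x² + 168x³ + 456x⁴ + 156x⁵`.
[cite: Balaban1988Convergent, (3.66) p.283] -/
theorem irrelevant366_le_selfAdjoint [StarRing 𝔸] [StarModule ℂ 𝔸] (τ : 𝔸 →L[ℂ] ℂ)
    (htr : ∀ a b : 𝔸, τ (a * b) = τ (b * a)) (hτ1 : τ 1 = 1) (hτn : ∀ a : 𝔸, ‖τ a‖ ≤ ‖a‖)
    (hstar : ∀ a : 𝔸, τ (star a) = starRingEnd ℂ (τ a)) (N : ℕ) (B : (Fin 4 → ℤ) → Fin 4 → 𝔸) {a σ θ : ℝ}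
    (ha : 0 ≤ a) (hσ : 0 < σ) (hσθ : σ ≤ θ) (hθ : θ ≤ 1) (hs : 16 * (a * σ) ≤ (N : ℝ) + 1)
    (hsa : ∀ m ∈ Fintype.piFinset (fun _ : Fin 4 => Finset.Icc (-((N : ℤ) + 1)) ((N : ℤ) + 1)), ∀ μ,
      IsSelfAdjoint (B m μ))
    (hB : ∀ m ∈ Fintype.piFinset (fun _ : Fin 4 => Finset.Icc (-((N : ℤ) + 1)) ((N : ℤ) + 1)), ∀ μ,
      ‖B m μ‖ ≤ a * σ)
    (hD : ∀ m ∈ Fintype.piFinset (fun _ : Fin 4 => Finset.Icc (-(N : ℤ)) N), ∀ μ ν,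
      ‖B (m + Pi.single ν 1) μ - B m μ‖ ≤ ((N : ℝ) + 1)⁻¹ * (a * σ ^ 2))
    (hH : ∀ m ∈ Fintype.piFinset (fun _ : Fin 4 => Finset.Icc (-(N : ℤ)) N), ∀ μ ν,
      ‖(B (m + Pi.single ν 1) μ - B m μ) - (B (Pi.single ν 1) μ - B 0 μ)‖
        ≤ ((N : ℝ) + 1)⁻¹ * (a * σ ^ 2 * θ)) :
    |∑ m ∈ Fintype.piFinset (fun _ : Fin 4 => Finset.Icc (-(N : ℤ)) N),
        (∏ i, (1 - |(m i : ℝ)| / ((N : ℝ) + 1)))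
          * ∑ d ∈ Finset.univ.filter (fun d : Fin 4 × Fin 4 => d.1 < d.2),
            (1 - (τ (plaqHol ((N : ℝ) + 1)⁻¹ (B m d.1) (B m d.2) (B (m + Pi.single d.2 1) d.1)
              (B (m + Pi.single d.1 1) d.2))).re)
      - 2⁻¹ * ∑ d ∈ Finset.univ.filter (fun d : Fin 4 × Fin 4 => d.1 < d.2),
          (τ (plaqF ((N : ℝ) + 1)⁻¹ (B 0 d.1) (B 0 d.2) (B (Pi.single d.2 1) d.1)
            (B (Pi.single d.1 1) d.2) ^ 2)).re|
      ≤ (24 * (4 * a) ^ 2 + 168 * (4 * a) ^ 3 + 456 * (4 * a) ^ 4 + 156 * (4 * a) ^ 5) * σ ^ 4 * θ := by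
  have hN1 : (0 : ℝ) < (N : ℝ) + 1 := by positivity
  have hσ0 := hσ.le
  have hθ0 : 0 ≤ θ := hσ0.trans hσθ
  have ha4 : 0 ≤ 4 * a := by positivity
  -- membership of the plaquette corners in the big box
  have hbig : ∀ m ∈ Fintype.piFinset (fun _ : Fin 4 => Finset.Icc (-(N : ℤ)) N), ∀ ν : Fin 4,
      m ∈ Fintype.piFinset (fun _ : Fin 4 => Finset.Icc (-((N : ℤ) + 1)) ((N : ℤ) + 1)) ∧
      m + Pi.single ν 1 ∈ Fintype.piFinset (fun _ : Fin 4 => Finset.Icc (-((N : ℤ) + 1)) ((N : ℤ) + 1)) := by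
    intro m hm ν
    have hmi := fun i => Finset.mem_Icc.mp (Fintype.mem_piFinset.mp hm i)
    refine ⟨Fintype.mem_piFinset.mpr fun i => Finset.mem_Icc.mpr ⟨?_, ?_⟩,
      Fintype.mem_piFinset.mpr fun i => Finset.mem_Icc.mpr ⟨?_, ?_⟩⟩
    · have := (hmi i).1; omega
    · have := (hmi i).2; omega
    · rw [Pi.add_apply, Pi.single_apply]
      have := (hmi i).1; split_ifs <;> omega
    · rw [Pi.add_apply, Pi.single_apply]
      have := (hmi i).2; split_ifs <;> omega
  -- the displacement letter, derived
  have hdisp : ∀ m ∈ Fintype.piFinset (fun _ : Fin 4 => Finset.Icc (-(N : ℤ)) N), ∀ μ,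
      ‖B m μ - B 0 μ‖ ≤ (4 * a) * σ ^ 2 := by
    intro m hm μ
    have h := norm_sub_origin_le_of_steps N (fun x => B x μ) (fun x hx ν => hD x hx μ ν) hm
    refine h.trans ?_
    have hNξ : (N : ℝ) * ((N : ℝ) + 1)⁻¹ ≤ 1 := by
      rw [← div_eq_mul_inv, div_le_one hN1]; linarith
    have : 4 * (N : ℝ) * (((N : ℝ) + 1)⁻¹ * (a * σ ^ 2)) = ((N : ℝ) * ((N : ℝ) + 1)⁻¹) * (4 * a * σ ^ 2) := by
      ring
    rw [this]
    have h4 : 0 ≤ 4 * a * σ ^ 2 := by positivity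
    calc ((N : ℝ) * ((N : ℝ) + 1)⁻¹) * (4 * a * σ ^ 2) ≤ 1 * (4 * a * σ ^ 2) :=
          mul_le_mul_of_nonneg_right hNξ h4
      _ = (4 * a) * σ ^ 2 := by ring
  -- the reality of τ on the curls, derived
  have hreal : ∀ m ∈ Fintype.piFinset (fun _ : Fin 4 => Finset.Icc (-(N : ℤ)) N), ∀ μ ν,
      (τ (plaqD ((N : ℝ) + 1)⁻¹ (B m μ) (B m ν) (B (m + Pi.single ν 1) μ) (B (m + Pi.single μ 1) ν))).im = 0 :=
    fun m hm μ ν => im_trace_plaqD_eq_zero τ hstar _ (hsa m (hbig m hm 0).1 μ) (hsa m (hbig m hm 0).1 ν)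
      (hsa _ (hbig m hm ν).2 μ) (hsa _ (hbig m hm μ).2 ν)
  -- the letters with `4a`
  have hs' : 4 * ((4 * a) * σ) ≤ (N : ℝ) + 1 := by linarith
  have hB' : ∀ m ∈ Fintype.piFinset (fun _ : Fin 4 => Finset.Icc (-((N : ℤ) + 1)) ((N : ℤ) + 1)), ∀ μ,
      ‖B m μ‖ ≤ (4 * a) * σ := fun m hm μ => (hB m hm μ).trans (by nlinarith)
  have hD' : ∀ m ∈ Fintype.piFinset (fun _ : Fin 4 => Finset.Icc (-(N : ℤ)) N), ∀ μ ν,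
      ‖B (m + Pi.single ν 1) μ - B m μ‖ ≤ ((N : ℝ) + 1)⁻¹ * ((4 * a) * σ ^ 2) := fun m hm μ ν =>
    (hD m hm μ ν).trans (mul_le_mul_of_nonneg_left (by nlinarith [pow_nonneg hσ0 2]) (inv_nonneg.mpr hN1.le))
  have hH' : ∀ m ∈ Fintype.piFinset (fun _ : Fin 4 => Finset.Icc (-(N : ℤ)) N), ∀ μ ν,
      ‖(B (m + Pi.single ν 1) μ - B m μ) - (B (Pi.single ν 1) μ - B 0 μ)‖
        ≤ ((N : ℝ) + 1)⁻¹ * ((4 * a) * σ ^ 2 * θ) := fun m hm μ ν =>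
    (hH m hm μ ν).trans (mul_le_mul_of_nonneg_left (by nlinarith [mul_nonneg (pow_nonneg hσ0 2) hθ0])
      (inv_nonneg.mpr hN1.le))
  exact irrelevant366_le τ htr hτ1 hτn N B ha4 hσ hσθ hθ hs' hB' hD' hdisp hH' hreal

end Consumer


end Literature.MathematicalPhysics.QuantumFieldTheory.Balaban1983to89.B14.Eq366Irrelevant
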